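import Literature.MathematicalPhysics.QuantumManyBody.TorusBoseFockLayer
import Mathlib.RingTheory.MvPolynomial.Homogeneous
import Mathlib.RingTheory.MvPolynomial.EulerIdentity
import Mathlib.Analysis.SpecificLimits.Normed
import Mathlib.Analysis.InnerProductSpace.Defs
import HarnessLib

/-!
# The Bogoliubov–Weyl calculus in the holomorphic Fock model: the Gaussian vector `Γ`
# (sectors, `∂_qΓ = ℓ_qΓ`, decay of `‖Γ_m‖²`, dressed inner product), the generators `b_q, b†_q`,
# the map `𝒯ξ = ξ(b†)1`, the Wick isometry and `T*W* a^♯ WT = γa^♯ + σa^♯_{-·} + √N₀δ`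

Topic `Literature/MathematicalPhysics/QuantumManyBody`, namespace `BoseGas.Fock` (layer A of
`TorusBoseFockLayer.lean`: the finite-excitation bosonic Fock space over a set of modes `ι` in the
holomorphic (Bargmann) model `MvPolynomial ι ℂ`, `a†_q = X_q·`, `a_q = ∂_q`, Fock inner product
`fockInner`). First file of the **Bogoliubov–Weyl calculus** needed for the trial state
`Ψ_N = W(N₀) T_ν e^{A_ν}Ω / ‖…‖` of [BastiCenatiempoSchlein2021, (2.12)] (provefact
`Literature.MathematicalPhysics.QuantumManyBody.BoseGas.BastiCenatiempoSchlein2021_upperBound`,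
Prop. 1.3): the Weyl operator `W(N₀) = exp(√N₀(a†₀ - a₀))` [ibid., (2.1)–(2.2)] and the
Bogoliubov transformation `T_ν = exp(½∑ν_p(a†_pa†_{-p} - h.c.))` [ibid., (2.10)–(2.11)] act on the
vacuum by producing the (unnormalised) **Gaussian vector**
`Γ = exp(√N₀ a†_z + ∑_{p∈P} t_p a†_p a†_{σp})Ω`, `t_p = tanh ν_p`,
which in the holomorphic model is the entire function `exp(√N₀ X_z + B)`, `B = ∑_{p∈P} t_pX_pX_{σp}`.
It is not a finite-excitation vector; this file handles it **sector by sector**, entirely inside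
`MvPolynomial ι ℂ`, for abstract data: a condensate mode `z`, an involution `σ` of the modes
(momentum reversal `p ↦ -p`) fixing `z`, a finite set `P` of pair representatives with
`σ(P) ∩ P = ∅`, `N₀ ≥ 0` and real pair amplitudes `t` with `|t_p| < 1`.

* `pairCoeff` (`t̃`, the even extension of `t`), `pairForm` (`B`), `gaussScalar`, `gaussSector`
  (`Γ_m = ∑_{j+2k=m} (√N₀)^j/(j!k!) X_z^j B^k`, homogeneous of degree `m`, `Γ_0 = 1`),
  `logDeriv` (`ℓ_q = √N₀[q=z] + t̃_qX_{σq} = ∂_q(√N₀X_z + B)`), `sectorMul`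
  (`(QΓ)_m = ∑_k Q_kΓ_{m-k}` for a polynomial `Q`), `gaussInner`
  (`⟪Q, Q'⟫_Γ = ⟨QΓ, Q'Γ⟩ = ∑_m ⟨(QΓ)_m, (Q'Γ)_m⟩`), `fockCore` (Cauchy–Schwarz packaging).
* **LEMMA B** `pderiv_gaussSector_succ`: `∂_qΓ_{m+1} = √N₀[q=z]Γ_m + t̃_qX_{σq}Γ_{m-1}` — the
  sector form of `a_qΓ = ℓ_qΓ` (`a_z` acts on the coherent factor as `√N₀`, [ibid., (2.2)];
  `a_q` acts on the squeezed vacuum as `t̃_q a†_{σq}`, the vacuum case of [ibid., (2.11)]);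
  consequences `sectorMul_X_mul_succ` (`((X_qQ)Γ)_{m+1} = X_q(QΓ)_m`) and `pderiv_sectorMul_succ`
  (`∂_q(QΓ)_{m+1} = ((∂_q + ℓ_q)QΓ)_m`).
* **LEMMA A** `gaussSector_norm_decay`, `sectorMul_norm_le`, `summable_norm_fockInner_sectorMul`:
  `‖Γ_m‖² ≤ A r^m` with `r < 1`, hence `‖(QΓ)_m‖² ≤ C_Q(m+1)^{deg Q+1}r^m` and absolute
  convergence of every `⟪Q, Q'⟫_Γ` — the analytic content of the unitarity of `W(N₀)` and `T_ν`
  on these vectors. Proof without coefficient formulas: Euler's identity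
  `∑_q‖∂_qA‖² = m‖A‖²` (`sum_fockInner_pderiv_self`), the CCR identity
  `‖X_qA‖² = ‖A‖² + ‖∂_qA‖²` (`fockInner_X_mul_self`) and LEMMA B give the recursion
  `(m+2)‖Γ_{m+2}‖² ≤ N₀‖Γ_{m+1}‖² + (∑t̃² + θm)‖Γ_m‖²`, `θ = max t̃² < 1`
  (`gaussSector_norm_recursion`), whence the decay by strong induction
  (`decay_of_norm_recursion`); the passage to `(QΓ)_m` uses Cauchy–Schwarz
  (`norm_fockInner_le_add_half`, `fockInner_sum_self_re_le`) and
  `‖X^eΓ_j‖² ≤ (j+|e|)^{|e|}‖Γ_j‖²` (`fockInner_monomial_mul_self_re_le`).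
* **LEMMA C** `gaussInner_X_mul_left`/`_right`: `⟪X_qQ, Q'⟫_Γ = ⟪Q, (∂_q + ℓ_q)Q'⟫_Γ` — in the
  Gaussian picture `Q ↦ QΓ` the creation operator stays `X_q·` and the annihilation operator
  becomes `d_q = ∂_q + ℓ_q·`, mutually adjoint for `⟪·,·⟫_Γ`; with sesquilinearity, Hermitian
  symmetry, positivity and `re⟪1,1⟫_Γ ≥ 1`.

**F2 (second half of the file).** On the Gaussian picture `Q ↦ QΓ` the creation operator is
`X_q·` and the annihilation operator is `d_q = ∂_q + ℓ_q·` (`dOp`; LEMMA C = mutual adjointness,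
`gaussInner_cr_left`, `gaussInner_dOp_left`). With the Bogoliubov amplitudes
`γ_q = (1-t̃_q²)^{-1/2} = cosh ν_q`, `σ_q = t̃_qγ_q = sinh ν_q` (`bogGamma`, `bogSigma`;
`γ² - σ² = 1`, evenness, `γ_z = 1`, `σ_z = 0`) the **Bogoliubov–Weyl generators**
`b_q = γ_qd_q - σ_qX_{σq} - √N₀[q=z]`, `b†_q = γ_qX_q - σ_qd_{σq} - √N₀[q=z]` (`bAn`, `bCr`) are
mutually adjoint (`gaussInner_bCr_left`, `gaussInner_bAn_left`), satisfy the CCR (`bAn_bCr`,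
`bCr_bCr_comm`, `bAn_bAn_comm`), reduce to `b_q = γ_q∂_q` (`bAn_apply`, so `b_q1 = 0`,
`bAn_one`) and `b†_q = γ_q⁻¹X_q - σ_q∂_{σq} - √N₀[q=z]` (`bCr_apply`), and invert to the
**conjugation formulas** `d_q = γ_qb_q + σ_qb†_{σq} + √N₀[q=z]`,
`X_q = γ_qb†_q + σ_qb_{σq} + √N₀[q=z]` (`dOp_eq_bAn_bCr`, `cr_eq_bCr_bAn`) — literally
`W*a₀W = a₀ + √N₀` [ibid., (2.2)] and `T*a_pT = γ_pa_p + σ_pa*_{-p}` [ibid., (2.11)]. The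
**Bogoliubov–Weyl map** `𝒯ξ = ξ(b†)1` (`bogT`, via `MvPolynomial.aeval` into the commutative
subalgebra of `End` generated by the `b†_q`, `bogTHom`) satisfies `𝒯(X_qξ) = b†_q𝒯ξ`,
`𝒯(∂_qξ) = b_q𝒯ξ`, `𝒯1 = 1` (`bogT_X_mul`, `bogT_pderiv`, `bogT_C`), the **Wick isometry**
`⟪𝒯ξ, 𝒯ξ'⟫_Γ = ⟪1,1⟫_Γ⟨ξ, ξ'⟩` (`gaussInner_bogT_bogT`) and the **master intertwining
identities** `X_q𝒯ξ = 𝒯((γ_qa†_q + σ_qa_{σq} + √N₀[q=z])ξ)`,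
`d_q𝒯ξ = 𝒯((γ_qa_q + σ_qa†_{σq} + √N₀[q=z])ξ)` (`X_mul_bogT`, `dOp_bogT`, with `conjCr`,
`conjAn`). Consequently, for the trial vectors `Ψ = (𝒯ξ)Γ = W(N₀)T_νξ` of
[ibid., (2.12)] every expectation of a word in `a, a†` — read sector by sector through
`sectorMul_X_mul_succ` and `pderiv_sectorMul_succ` — equals `‖Γ‖²` times the Fock expectation
in the finite-excitation vector `ξ` of the conjugated word, which is the identity
`⟨Ψ_N, ℋ_NΨ_N⟩ = ⟨ξ_ν, 𝒢_Nξ_ν⟩/‖ξ_ν‖²`, `𝒢_N = T*W*ℋ_NWT`, of [ibid., (3.1)].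

## References

* [BastiCenatiempoSchlein2021] G. Basti, S. Cenatiempo, B. Schlein, *A new second-order upper bound
  for the ground state energy of dilute Bose gases*, Forum Math. Sigma 9 (2021) e74
  (arXiv:2101.06222), §2: (2.1)–(2.2) (Weyl operator), (2.10)–(2.11) (Bogoliubov transformation),
  (2.12) (the trial state); §3, (3.1) (`𝒢_N = T*W*ℋWT`).
* [LSSY2005] E. H. Lieb, R. Seiringer, J. P. Solovej, J. Yngvason, *The Mathematics of the Bose Gas
  and its Condensation* (2005), App. A (second quantisation, `a†` adjoint to `a`).
* Tree: `TorusBoseFockLayer.lean` (layer A: `cr`, `an`, CCR, `fockInner`, `fockInner_cr_left`);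
  Mathlib: `MvPolynomial.IsHomogeneous.sum_X_mul_pderiv` (Euler), `homogeneousComponent`,
  `PreInnerProductSpace.Core`.
-/

noncomputable section

namespace Literature.MathematicalPhysics.QuantumManyBody.BoseGas

open Complex MvPolynomial Finset
open scoped ComplexConjugate BigOperators

namespace Fock

variable {ι : Type*}

/-! ### The Gaussian data: condensate mode `z`, pairing involution `σ`, pair representatives `P`,
condensate amplitude `√N₀`, pair amplitudes `t` -/

/-- The **pair amplitude** `t_p` extended evenly to all modes: `t_p` on the representatives
`p ∈ P`, `t_{σp}` on their partners, `0` on the condensate mode and on inert modes.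
[cite: BastiCenatiempoSchlein2021, (2.9)–(2.10) (`ν_p = ν_{-p}`, `T_ν`)] -/
def pairCoeff [DecidableEq ι] (σ : ι → ι) (P : Finset ι) (t : ι → ℝ) (p : ι) : ℝ :=
  if p ∈ P then t p else if σ p ∈ P then t (σ p) else 0

/-- The **pair form** `B = ∑_{p∈P} t_p X_p X_{σp}` (the exponent of the product of the two-mode
squeezed vacua of the pairs `{p, σp}` in the holomorphic model, `t_p = tanh ν_p`).
[cite: BastiCenatiempoSchlein2021, (2.10)] -/
def pairForm (σ : ι → ι) (P : Finset ι) (t : ι → ℝ) : MvPolynomial ι ℂ :=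
  ∑ p ∈ P, C ((t p : ℝ) : ℂ) * (X p * X (σ p))

/-- The scalar coefficients `c_{m,k} = (√N₀)^{m-2k}/((m-2k)! k!)` of `Γ_m` (`0` if `2k > m`).
[folklore] -/
def gaussScalar (N₀ : ℝ) (m k : ℕ) : ℝ :=
  if 2 * k ≤ m then Real.sqrt N₀ ^ (m - 2 * k) / ((m - 2 * k).factorial * k.factorial) else 0

/-- The **`m`-particle sector of the Gaussian vector**
`Γ = exp(√N₀ X_z + B) = ∑_m Γ_m`, `Γ_m = ∑_{j+2k=m} (√N₀)^j/(j!k!) X_z^j B^k`, a homogeneous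
polynomial of degree `m` in the holomorphic (Bargmann) model `MvPolynomial ι ℂ` of the
finite-excitation Fock space (`TorusBoseFockLayer.lean`, layer A): the coherent state
`W(N₀)Ω ∝ exp(√N₀ a†_z)Ω` in the condensate mode times the squeezed vacuum `T_νΩ ∝ exp(B)Ω`.
[cite: BastiCenatiempoSchlein2021, (2.1)–(2.2), (2.10)] -/
def gaussSector (z : ι) (σ : ι → ι) (P : Finset ι) (N₀ : ℝ) (t : ι → ℝ) (m : ℕ) :
    MvPolynomial ι ℂ :=
  ∑ k ∈ range (m + 1), C ((gaussScalar N₀ m k : ℝ) : ℂ) * (X z ^ (m - 2 * k) * pairForm σ P t ^ k)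

/-- The **logarithmic derivative** `ℓ_q = ∂_q(√N₀ X_z + B) = √N₀ [q = z] + t̃_q X_{σq}`
(a polynomial of degree `≤ 1`): `∂_q Γ = ℓ_q Γ`. [folklore] -/
def logDeriv [DecidableEq ι] (z : ι) (σ : ι → ι) (P : Finset ι) (N₀ : ℝ) (t : ι → ℝ) (q : ι) :
    MvPolynomial ι ℂ :=
  C (((if q = z then Real.sqrt N₀ else 0 : ℝ) : ℂ)) + C ((pairCoeff σ P t q : ℝ) : ℂ) * X (σ q)

/-- The **`m`-particle sector of `Q·Γ`** for a finite-excitation vector (polynomial) `Q`: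
`(QΓ)_m = ∑_{k ≤ m} Q_k Γ_{m-k}`, `Q_k` the homogeneous components of `Q`. Every vector of the
Bogoliubov–Weyl calculus is of this form. [folklore] -/
def sectorMul [DecidableEq ι] (z : ι) (σ : ι → ι) (P : Finset ι) (N₀ : ℝ) (t : ι → ℝ)
    (Q : MvPolynomial ι ℂ) (m : ℕ) : MvPolynomial ι ℂ :=
  ∑ k ∈ range (m + 1), homogeneousComponent k Q * gaussSector z σ P N₀ t (m - k)

/-! ### Basic properties of the data -/

section Basic

variable {z : ι} {σ : ι → ι} {P : Finset ι} {N₀ : ℝ} {t : ι → ℝ}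

/-- The condensate mode is not a pair representative (`σz = z`, `σ(P) ∩ P = ∅`). [folklore] -/
theorem not_mem_of_partner (hP : ∀ p ∈ P, σ p ∉ P) (hσz : σ z = z) : z ∉ P :=
  fun h => hP z h (by rwa [hσz])

section PairCoeff

variable [DecidableEq ι]

/-- `t̃_p = t_p` on `P`. [folklore] -/
theorem pairCoeff_of_mem {p : ι} (hp : p ∈ P) : pairCoeff σ P t p = t p := by
  simp [pairCoeff, hp]

/-- `t̃_p = t_{σp}` on `σ(P)`. [folklore] -/
theorem pairCoeff_of_partner_mem {p : ι} (hp : p ∉ P) (hσp : σ p ∈ P) :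
    pairCoeff σ P t p = t (σ p) := by
  simp [pairCoeff, hp, hσp]

/-- `t̃_p = 0` on inert modes. [folklore] -/
theorem pairCoeff_of_inert {p : ι} (hp : p ∉ P) (hσp : σ p ∉ P) : pairCoeff σ P t p = 0 := by
  simp [pairCoeff, hp, hσp]

/-- `t̃_z = 0`: the condensate mode is not squeezed. [folklore] -/
theorem pairCoeff_z (hP : ∀ p ∈ P, σ p ∉ P) (hσz : σ z = z) : pairCoeff σ P t z = 0 :=
  pairCoeff_of_inert (not_mem_of_partner hP hσz) (by rw [hσz]; exact not_mem_of_partner hP hσz)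

/-- `t̃` is even: `t̃_{σq} = t̃_q`. [folklore] -/
theorem pairCoeff_partner (hσ : Function.Involutive σ) (hP : ∀ p ∈ P, σ p ∉ P) (q : ι) :
    pairCoeff σ P t (σ q) = pairCoeff σ P t q := by
  by_cases h1 : q ∈ P
  · rw [pairCoeff_of_mem h1, pairCoeff_of_partner_mem (hP q h1) (by rwa [hσ q]), hσ q]
  · by_cases h2 : σ q ∈ P
    · rw [pairCoeff_of_partner_mem h1 h2, pairCoeff_of_mem h2]
    · rw [pairCoeff_of_inert h1 h2, pairCoeff_of_inert h2 (by rwa [hσ q])]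

/-- `|t̃_p| < 1` everywhere if `|t_p| < 1` on `P`. [folklore] -/
theorem abs_pairCoeff_lt_one (ht : ∀ p ∈ P, |t p| < 1) (p : ι) : |pairCoeff σ P t p| < 1 := by
  unfold pairCoeff
  split_ifs with h1 h2
  · exact ht p h1
  · exact ht _ h2
  · simp

/-- **`∂_q B = t̃_q X_{σq}`.** [folklore] -/
theorem pderiv_pairForm (hσ : Function.Involutive σ) (hP : ∀ p ∈ P, σ p ∉ P) (q : ι) :
    pderiv q (pairForm σ P t) = C ((pairCoeff σ P t q : ℝ) : ℂ) * X (σ q) := by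
  unfold pairForm
  rw [map_sum]
  have hterm : ∀ p ∈ P, pderiv q (C ((t p : ℝ) : ℂ) * (X p * X (σ p))) =
      C ((t p : ℝ) : ℂ) * ((if p = q then X (σ p) else 0) + (if σ p = q then X p else 0)) := by
    intro p _
    rw [pderiv_C_mul, pderiv_mul, pderiv_X, pderiv_X]
    congr 1
    simp only [Pi.single_apply]
    split_ifs <;> ring
  rw [Finset.sum_congr rfl hterm]
  simp_rw [mul_add, Finset.sum_add_distrib]
  by_cases h1 : q ∈ P
  · -- first sum: only `p = q`; second sum: `σ p = q` forces `p = σ q ∉ P`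
    rw [pairCoeff_of_mem h1]
    have hs1 : ∑ p ∈ P, C ((t p : ℝ) : ℂ) * (if p = q then X (σ p) else 0) =
        C ((t q : ℝ) : ℂ) * X (σ q) := by
      rw [Finset.sum_eq_single q (fun p _ hp => by simp [hp]) (fun h => absurd h1 h)]
      simp
    have hs2 : ∑ p ∈ P, C ((t p : ℝ) : ℂ) * (if σ p = q then X p else 0) = 0 := by
      refine Finset.sum_eq_zero fun p hp => ?_
      have : σ p ≠ q := fun h => hP q h1 (by rw [← h, hσ p]; exact hp)
      simp [this]
    rw [hs1, hs2, add_zero]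
  · by_cases h2 : σ q ∈ P
    · rw [pairCoeff_of_partner_mem h1 h2]
      have hs1 : ∑ p ∈ P, C ((t p : ℝ) : ℂ) * (if p = q then X (σ p) else 0) = 0 := by
        refine Finset.sum_eq_zero fun p hp => ?_
        have : p ≠ q := fun h => h1 (h ▸ hp)
        simp [this]
      have hs2 : ∑ p ∈ P, C ((t p : ℝ) : ℂ) * (if σ p = q then X p else 0) =
          C ((t (σ q) : ℝ) : ℂ) * X (σ q) := by
        rw [Finset.sum_eq_single (σ q) (fun p _ hp => by
          have : σ p ≠ q := fun h => hp (by rw [← h, hσ p])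
          simp [this]) (fun h => absurd h2 h)]
        simp [hσ q]
      rw [hs1, hs2, zero_add]
    · rw [pairCoeff_of_inert h1 h2]
      have hs1 : ∑ p ∈ P, C ((t p : ℝ) : ℂ) * (if p = q then X (σ p) else 0) = 0 := by
        refine Finset.sum_eq_zero fun p hp => ?_
        have : p ≠ q := fun h => h1 (h ▸ hp)
        simp [this]
      have hs2 : ∑ p ∈ P, C ((t p : ℝ) : ℂ) * (if σ p = q then X p else 0) = 0 := by
        refine Finset.sum_eq_zero fun p hp => ?_
        have : σ p ≠ q := fun h => h2 (by rw [← h, hσ p]; exact hp)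
        simp [this]
      rw [hs1, hs2, add_zero]
      simp

end PairCoeff

/-- `B` is homogeneous of degree `2`. [folklore] -/
theorem isHomogeneous_pairForm : (pairForm σ P t).IsHomogeneous 2 := by
  unfold pairForm
  apply IsHomogeneous.sum
  intro p _
  exact (isHomogeneous_C _ _).mul ((isHomogeneous_X _ _).mul (isHomogeneous_X _ _))

/-! ### The scalars `c_{m,k}` -/

/-- `c_{m,k} = 0` for `2k > m`. [folklore] -/
theorem gaussScalar_of_lt {m k : ℕ} (h : m < 2 * k) : gaussScalar N₀ m k = 0 := by
  simp [gaussScalar, Nat.not_le.2 h]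

/-- `c_{0,0} = 1`. [folklore] -/
theorem gaussScalar_zero_zero : gaussScalar N₀ 0 0 = 1 := by
  simp [gaussScalar]

/-- `(m+1-2k) c_{m+1,k} = √N₀ c_{m,k}` (the condensate recursion). [folklore] -/
theorem sub_mul_gaussScalar_succ (m k : ℕ) :
    ((m + 1 - 2 * k : ℕ) : ℝ) * gaussScalar N₀ (m + 1) k = Real.sqrt N₀ * gaussScalar N₀ m k := by
  unfold gaussScalar
  by_cases h : 2 * k ≤ m
  · have h' : 2 * k ≤ m + 1 := by omega
    rw [if_pos h', if_pos h]
    have hsub : m + 1 - 2 * k = (m - 2 * k) + 1 := by omega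
    rw [hsub, Nat.factorial_succ, pow_succ]
    push_cast
    have hf : ((m - 2 * k).factorial : ℝ) ≠ 0 := by positivity
    have hk : (k.factorial : ℝ) ≠ 0 := by positivity
    have hm : ((m - 2 * k : ℕ) : ℝ) + 1 ≠ 0 := by positivity
    field_simp
  · rw [if_neg h]
    by_cases h' : 2 * k ≤ m + 1
    · have : m + 1 - 2 * k = 0 := by omega
      rw [this]; simp
    · rw [if_neg h']; simp

/-- `k c_{m+1,k} = c_{m-1,k-1}` for `k, m ≥ 1` (the pair recursion). [folklore] -/
theorem mul_gaussScalar_succ {m k : ℕ} (hm : 1 ≤ m) (hk : 1 ≤ k) :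
    (k : ℝ) * gaussScalar N₀ (m + 1) k = gaussScalar N₀ (m - 1) (k - 1) := by
  unfold gaussScalar
  by_cases h : 2 * k ≤ m + 1
  · have h' : 2 * (k - 1) ≤ m - 1 := by omega
    rw [if_pos h, if_pos h']
    have hsub : m - 1 - 2 * (k - 1) = m + 1 - 2 * k := by omega
    rw [hsub]
    obtain ⟨j, rfl⟩ : ∃ j, k = j + 1 := ⟨k - 1, by omega⟩
    rw [Nat.add_sub_cancel, Nat.factorial_succ]
    push_cast
    have hf : ((m + 1 - 2 * (j + 1)).factorial : ℝ) ≠ 0 := by positivity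
    have hj : (j.factorial : ℝ) ≠ 0 := by positivity
    have hj1 : ((j : ℕ) : ℝ) + 1 ≠ 0 := by positivity
    field_simp
  · have h' : ¬ 2 * (k - 1) ≤ m - 1 := by omega
    rw [if_neg h, if_neg h']; simp

/-! ### The sectors `Γ_m` -/

/-- `Γ_0 = 1` (the vacuum component). [folklore] -/
theorem gaussSector_zero : gaussSector z σ P N₀ t 0 = 1 := by
  simp [gaussSector, gaussScalar_zero_zero]

/-- `Γ_m` is homogeneous of degree `m`. [folklore] -/
theorem isHomogeneous_gaussSector (m : ℕ) : (gaussSector z σ P N₀ t m).IsHomogeneous m := by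
  unfold gaussSector
  apply IsHomogeneous.sum
  intro k hk
  by_cases h : 2 * k ≤ m
  · have hdeg : (X z ^ (m - 2 * k) * pairForm σ P t ^ k).IsHomogeneous m := by
      have := ((isHomogeneous_X (R := ℂ) z).pow (m - 2 * k)).mul
        ((isHomogeneous_pairForm (σ := σ) (P := P) (t := t)).pow k)
      convert this using 1
      omega
    exact hdeg.C_mul _
  · rw [gaussScalar_of_lt (Nat.not_le.1 h)]
    simp only [Complex.ofReal_zero, C_0, zero_mul]
    exact isHomogeneous_zero _ _ _

/-- The `k = m+1` term of `Γ_m` written over `range (m+2)` vanishes, so the defining sum of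
`Γ_m` may be taken over `range (m+2)`. [folklore] -/
theorem gaussSector_eq_sum_range_succ (m : ℕ) :
    gaussSector z σ P N₀ t m =
      ∑ k ∈ range (m + 2), C ((gaussScalar N₀ m k : ℝ) : ℂ) *
        (X z ^ (m - 2 * k) * pairForm σ P t ^ k) := by
  rw [gaussSector, Finset.sum_range_succ _ (m + 1), gaussScalar_of_lt (by omega)]
  simp

/-- **LEMMA B: `∂_q Γ_{m+1} = √N₀[q = z] Γ_m + t̃_q X_{σq} Γ_{m-1}`** — the sector form of
`∂_q Γ = ℓ_q Γ`, `ℓ_q = ∂_q(√N₀X_z + B)`: in the holomorphic model the annihilation operator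
`a_q = ∂_q` acts on the Gaussian vector as multiplication by the linear polynomial `ℓ_q`
(coherent states are eigenvectors of `a_z`; on the squeezed vacuum `a_q` acts as `t̃_q a†_{σq}`).
[cite: BastiCenatiempoSchlein2021, (2.2) and (2.11) (`W*a₀W = a₀ + √N₀`, `T*a_pT = γ_pa_p + σ_pa*_{-p}`)] -/
theorem pderiv_gaussSector_succ [DecidableEq ι] (hσ : Function.Involutive σ)
    (hP : ∀ p ∈ P, σ p ∉ P) (q : ι) (m : ℕ) :
    pderiv q (gaussSector z σ P N₀ t (m + 1)) =
      C (((if q = z then Real.sqrt N₀ else 0 : ℝ) : ℂ)) * gaussSector z σ P N₀ t m +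
        C ((pairCoeff σ P t q : ℝ) : ℂ) * X (σ q) *
          (if m = 0 then 0 else gaussSector z σ P N₀ t (m - 1)) := by
  set B : MvPolynomial ι ℂ := pairForm σ P t with hB
  set τ : ℂ := ((pairCoeff σ P t q : ℝ) : ℂ) with hτ
  set δ : ℂ := if z = q then 1 else 0 with hδ
  have hdB : pderiv q B = C τ * X (σ q) := pderiv_pairForm hσ hP q
  have hdX : pderiv q (X z : MvPolynomial ι ℂ) = C δ := by
    rw [pderiv_X, Pi.single_apply, hδ]
    split_ifs <;> simp
  -- termwise derivative
  have hterm : ∀ k ∈ range (m + 2),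
      pderiv q (C ((gaussScalar N₀ (m + 1) k : ℝ) : ℂ) * (X z ^ (m + 1 - 2 * k) * B ^ k)) =
        C δ * (C ((Real.sqrt N₀ * gaussScalar N₀ m k : ℝ) : ℂ) * (X z ^ (m - 2 * k) * B ^ k)) +
        C (((k : ℝ) * gaussScalar N₀ (m + 1) k : ℝ) : ℂ) * (X z ^ (m + 1 - 2 * k) * B ^ (k - 1)) *
          (C τ * X (σ q)) := by
    intro k _
    rw [pderiv_C_mul, pderiv_mul, pderiv_pow, pderiv_pow, hdB, hdX]
    have hexp : m + 1 - 2 * k - 1 = m - 2 * k := by omega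
    rw [hexp, ← sub_mul_gaussScalar_succ (N₀ := N₀) m k]
    push_cast
    rw [map_mul, map_mul, map_natCast, map_natCast]
    ring
  rw [gaussSector, map_sum, Finset.sum_congr rfl hterm, Finset.sum_add_distrib]
  -- first sum
  have hS1 : ∑ k ∈ range (m + 1 + 1),
      C δ * (C ((Real.sqrt N₀ * gaussScalar N₀ m k : ℝ) : ℂ) * (X z ^ (m - 2 * k) * B ^ k)) =
      C δ * C ((Real.sqrt N₀ : ℝ) : ℂ) * gaussSector z σ P N₀ t m := by
    rw [gaussSector_eq_sum_range_succ, Finset.mul_sum]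
    refine Finset.sum_congr rfl fun k _ => ?_
    push_cast
    rw [map_mul]
    ring
  -- second sum
  have hS2 : ∑ k ∈ range (m + 1 + 1),
      C (((k : ℝ) * gaussScalar N₀ (m + 1) k : ℝ) : ℂ) * (X z ^ (m + 1 - 2 * k) * B ^ (k - 1)) *
        (C τ * X (σ q)) =
      C τ * X (σ q) * (if m = 0 then 0 else gaussSector z σ P N₀ t (m - 1)) := by
    rw [Finset.sum_range_succ']
    simp only [Nat.cast_zero, zero_mul, Complex.ofReal_zero, C_0, add_zero]
    by_cases hm : m = 0
    · subst hm
      rw [if_pos rfl, mul_zero]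
      refine Finset.sum_eq_zero fun k _ => ?_
      rw [gaussScalar_of_lt (by omega)]
      simp
    · rw [if_neg hm]
      have hm1 : 1 ≤ m := Nat.one_le_iff_ne_zero.2 hm
      have hcong : ∀ k ∈ range (m + 1),
          C ((((k + 1 : ℕ) : ℝ) * gaussScalar N₀ (m + 1) (k + 1) : ℝ) : ℂ) *
              (X z ^ (m + 1 - 2 * (k + 1)) * B ^ (k + 1 - 1)) * (C τ * X (σ q)) =
            C τ * X (σ q) * (C ((gaussScalar N₀ (m - 1) k : ℝ) : ℂ) *
              (X z ^ (m - 1 - 2 * k) * B ^ k)) := by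
        intro k _
        rw [mul_gaussScalar_succ (N₀ := N₀) hm1 (by omega), Nat.add_sub_cancel,
          show m + 1 - 2 * (k + 1) = m - 1 - 2 * k by omega]
        ring
      rw [Finset.sum_congr rfl hcong, ← Finset.mul_sum]
      congr 1
      rw [show m + 1 = (m - 1) + 2 by omega, ← gaussSector_eq_sum_range_succ]
  rw [hS1, hS2]
  have hδ' : (C δ * C ((Real.sqrt N₀ : ℝ) : ℂ) : MvPolynomial ι ℂ) =
      C (((if q = z then Real.sqrt N₀ else 0 : ℝ) : ℂ)) := by
    rw [← map_mul, hδ]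
    by_cases h : q = z
    · rw [if_pos h, if_pos h.symm, one_mul]
    · rw [if_neg h, if_neg (Ne.symm h), zero_mul]; simp
  rw [hδ']

end Basic

/-! ### Homogeneous components versus `X_q ·` and `∂_q` -/

section Homogeneous

variable [DecidableEq ι]

omit [DecidableEq ι] in
/-- `deg (d + e_q) = deg d + 1`. [folklore] -/
theorem degree_add_single_one (d : ι →₀ ℕ) (q : ι) :
    (d + Finsupp.single q 1).degree = d.degree + 1 := by
  rw [map_add, Finsupp.degree_single]

/-- **`(X_q Q)_{k+1} = X_q Q_k`.** [folklore] -/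
theorem homogeneousComponent_X_mul_succ (q : ι) (Q : MvPolynomial ι ℂ) (k : ℕ) :
    homogeneousComponent (k + 1) (X q * Q) = X q * homogeneousComponent k Q := by
  refine MvPolynomial.ext _ _ fun d => ?_
  rw [coeff_homogeneousComponent, coeff_X_mul', coeff_X_mul', coeff_homogeneousComponent]
  by_cases hq : q ∈ d.support
  · rw [if_pos hq, if_pos hq]
    have hd : d = (d - Finsupp.single q 1) + Finsupp.single q 1 := by
      rw [Finsupp.sub_add_single_one_cancel (Finsupp.mem_support_iff.1 hq)]
    have hdeg : d.degree = (d - Finsupp.single q 1).degree + 1 := by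
      conv_lhs => rw [hd]
      exact degree_add_single_one _ _
    rw [hdeg]
    by_cases h : (d - Finsupp.single q 1).degree = k
    · rw [if_pos h, if_pos (by omega)]
    · rw [if_neg h, if_neg (by omega)]
  · rw [if_neg hq, if_neg hq]
    split_ifs <;> rfl

/-- **`(X_q Q)_0 = 0`.** [folklore] -/
theorem homogeneousComponent_X_mul_zero (q : ι) (Q : MvPolynomial ι ℂ) :
    homogeneousComponent 0 (X q * Q) = 0 := by
  refine MvPolynomial.ext _ _ fun d => ?_
  rw [coeff_homogeneousComponent, coeff_zero]
  by_cases hd : d.degree = 0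
  · rw [if_pos hd, (Finsupp.degree_eq_zero_iff d).1 hd, coeff_X_mul']
    simp
  · rw [if_neg hd]

omit [DecidableEq ι] in
/-- **`(∂_q Q)_k = ∂_q Q_{k+1}`.** [folklore] -/
theorem homogeneousComponent_pderiv (q : ι) (Q : MvPolynomial ι ℂ) (k : ℕ) :
    homogeneousComponent k (pderiv q Q) = pderiv q (homogeneousComponent (k + 1) Q) := by
  refine MvPolynomial.ext _ _ fun d => ?_
  rw [coeff_homogeneousComponent, coeff_pderiv, coeff_pderiv, coeff_homogeneousComponent,
    degree_add_single_one]
  by_cases h : d.degree = k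
  · rw [if_pos h, if_pos (by omega)]
  · rw [if_neg h, if_neg (by omega), zero_mul]

omit [DecidableEq ι] in
/-- `∂_q Q_0 = 0`. [folklore] -/
theorem pderiv_homogeneousComponent_zero (q : ι) (Q : MvPolynomial ι ℂ) :
    pderiv q (homogeneousComponent 0 Q) = 0 := by
  rw [homogeneousComponent_zero, pderiv_C]

omit [DecidableEq ι] in
/-- `1_k = [k = 0]`. [folklore] -/
theorem homogeneousComponent_one (k : ℕ) :
    homogeneousComponent k (1 : MvPolynomial ι ℂ) = if k = 0 then 1 else 0 := by
  by_cases hk : k = 0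
  · subst hk; simp
  · rw [if_neg hk]
    apply homogeneousComponent_eq_zero
    rw [totalDegree_one]; omega

end Homogeneous

/-! ### The sectors `(QΓ)_m` -/

section SectorMul

variable [DecidableEq ι] {z : ι} {σ : ι → ι} {P : Finset ι} {N₀ : ℝ} {t : ι → ℝ}

/-- `sectorMul` is additive in `Q`. [folklore] -/
theorem sectorMul_add (Q Q' : MvPolynomial ι ℂ) (m : ℕ) :
    sectorMul z σ P N₀ t (Q + Q') m = sectorMul z σ P N₀ t Q m + sectorMul z σ P N₀ t Q' m := by
  simp only [sectorMul, map_add, add_mul, Finset.sum_add_distrib]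

/-- `sectorMul` commutes with scalars `C c`. [folklore] -/
theorem sectorMul_C_mul (c : ℂ) (Q : MvPolynomial ι ℂ) (m : ℕ) :
    sectorMul z σ P N₀ t (C c * Q) m = C c * sectorMul z σ P N₀ t Q m := by
  simp only [sectorMul, homogeneousComponent_C_mul, mul_assoc, Finset.mul_sum]

/-- `sectorMul` is `ℂ`-homogeneous in `Q`. [folklore] -/
theorem sectorMul_smul (c : ℂ) (Q : MvPolynomial ι ℂ) (m : ℕ) :
    sectorMul z σ P N₀ t (c • Q) m = c • sectorMul z σ P N₀ t Q m := by
  rw [smul_eq_C_mul, sectorMul_C_mul, smul_eq_C_mul]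

/-- `(0·Γ)_m = 0`. [folklore] -/
theorem sectorMul_zero_left (m : ℕ) : sectorMul z σ P N₀ t 0 m = 0 := by
  simp [sectorMul]

/-- `sectorMul` of a finite sum. [folklore] -/
theorem sectorMul_sum_left {κ : Type*} (s : Finset κ) (Q : κ → MvPolynomial ι ℂ) (m : ℕ) :
    sectorMul z σ P N₀ t (∑ i ∈ s, Q i) m = ∑ i ∈ s, sectorMul z σ P N₀ t (Q i) m := by
  induction s using Finset.cons_induction with
  | empty => simp [sectorMul_zero_left]
  | cons a s ha ih => rw [Finset.sum_cons, Finset.sum_cons, sectorMul_add, ih]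

/-- **`(1·Γ)_m = Γ_m`.** [folklore] -/
theorem sectorMul_one (m : ℕ) : sectorMul z σ P N₀ t 1 m = gaussSector z σ P N₀ t m := by
  rw [sectorMul, Finset.sum_eq_single 0]
  · simp
  · intro k _ hk
    rw [homogeneousComponent_one, if_neg hk, zero_mul]
  · intro h; simp at h

/-- `(QΓ)_m` is homogeneous of degree `m`. [folklore] -/
theorem isHomogeneous_sectorMul (Q : MvPolynomial ι ℂ) (m : ℕ) :
    (sectorMul z σ P N₀ t Q m).IsHomogeneous m := by
  unfold sectorMul
  apply IsHomogeneous.sum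
  intro k hk
  have := (homogeneousComponent_isHomogeneous k Q).mul (isHomogeneous_gaussSector (z := z) (σ := σ)
    (P := P) (N₀ := N₀) (t := t) (m - k))
  convert this using 1
  have := Finset.mem_range.1 hk
  omega

/-- **`((X_q Q)Γ)_{m+1} = X_q (QΓ)_m`** (creation shifts the sector). [folklore] -/
theorem sectorMul_X_mul_succ (q : ι) (Q : MvPolynomial ι ℂ) (m : ℕ) :
    sectorMul z σ P N₀ t (X q * Q) (m + 1) = X q * sectorMul z σ P N₀ t Q m := by
  rw [sectorMul, Finset.sum_range_succ', homogeneousComponent_X_mul_zero, zero_mul, add_zero,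
    sectorMul, Finset.mul_sum]
  refine Finset.sum_congr rfl fun k _ => ?_
  rw [homogeneousComponent_X_mul_succ, show m + 1 - (k + 1) = m - k by omega, mul_assoc]

/-- **`((X_q Q)Γ)_0 = 0`.** [folklore] -/
theorem sectorMul_X_mul_zero (q : ι) (Q : MvPolynomial ι ℂ) :
    sectorMul z σ P N₀ t (X q * Q) 0 = 0 := by
  rw [sectorMul, Finset.sum_range_one, homogeneousComponent_X_mul_zero, zero_mul]

/-- **`∂_q (QΓ)_{m+1} = ((∂_qQ + ℓ_qQ)Γ)_m`** (annihilation in the Gaussian picture: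
`∂_q(QΓ) = (∂_qQ)Γ + Q ℓ_qΓ`). [folklore] -/
theorem pderiv_sectorMul_succ (hσ : Function.Involutive σ) (hP : ∀ p ∈ P, σ p ∉ P) (q : ι)
    (Q : MvPolynomial ι ℂ) (m : ℕ) :
    pderiv q (sectorMul z σ P N₀ t Q (m + 1)) =
      sectorMul z σ P N₀ t (pderiv q Q + logDeriv z σ P N₀ t q * Q) m := by
  set a : ℂ := ((if q = z then Real.sqrt N₀ else 0 : ℝ) : ℂ) with ha
  set b : ℂ := ((pairCoeff σ P t q : ℝ) : ℂ) with hb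
  have hℓ : logDeriv z σ P N₀ t q = C a + C b * X (σ q) := rfl
  -- expand the left-hand side
  rw [sectorMul, map_sum]
  have hterm : ∀ k ∈ range (m + 1 + 1),
      pderiv q (homogeneousComponent k Q * gaussSector z σ P N₀ t (m + 1 - k)) =
        pderiv q (homogeneousComponent k Q) * gaussSector z σ P N₀ t (m + 1 - k) +
        homogeneousComponent k Q * pderiv q (gaussSector z σ P N₀ t (m + 1 - k)) := by
    intro k _; rw [pderiv_mul]
  rw [Finset.sum_congr rfl hterm, Finset.sum_add_distrib]
  -- Term A: `∑ ∂Q_k Γ_{m+1-k} = ((∂Q)Γ)_m`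
  have hA : ∑ k ∈ range (m + 1 + 1), pderiv q (homogeneousComponent k Q) *
      gaussSector z σ P N₀ t (m + 1 - k) = sectorMul z σ P N₀ t (pderiv q Q) m := by
    rw [Finset.sum_range_succ', pderiv_homogeneousComponent_zero, zero_mul, add_zero, sectorMul]
    refine Finset.sum_congr rfl fun k _ => ?_
    rw [homogeneousComponent_pderiv, show m + 1 - (k + 1) = m - k by omega]
  -- Term B: `∑ Q_k ∂Γ_{m+1-k}`; the `k = m+1` term vanishes
  have hB : ∑ k ∈ range (m + 1 + 1), homogeneousComponent k Q *
      pderiv q (gaussSector z σ P N₀ t (m + 1 - k)) =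
      sectorMul z σ P N₀ t (C a * Q) m + sectorMul z σ P N₀ t (C b * X (σ q) * Q) m := by
    rw [Finset.sum_range_succ, Nat.sub_self, gaussSector_zero, pderiv_one, mul_zero, add_zero]
    have hcong : ∀ k ∈ range (m + 1), homogeneousComponent k Q *
        pderiv q (gaussSector z σ P N₀ t (m + 1 - k)) =
        C a * (homogeneousComponent k Q * gaussSector z σ P N₀ t (m - k)) +
        homogeneousComponent k Q * (C b * X (σ q) *
          (if m - k = 0 then 0 else gaussSector z σ P N₀ t (m - k - 1))) := by
      intro k hk
      have hk' := Finset.mem_range.1 hk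
      rw [show m + 1 - k = (m - k) + 1 by omega, pderiv_gaussSector_succ hσ hP q (m - k)]
      ring
    rw [Finset.sum_congr rfl hcong, Finset.sum_add_distrib, ← Finset.mul_sum]
    congr 1
    · rw [sectorMul_C_mul, sectorMul]
    · -- `∑_{k ≤ m} Q_k · CbX · Γ'_{m-k-1} = ((CbX Q)Γ)_m`
      rw [mul_assoc (C b), sectorMul_C_mul]
      rcases Nat.eq_zero_or_pos m with hm | hm
      · subst hm
        simp [sectorMul_X_mul_zero]
      · obtain ⟨n, rfl⟩ : ∃ n, m = n + 1 := ⟨m - 1, by omega⟩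
        rw [sectorMul_X_mul_succ, sectorMul, Finset.mul_sum, Finset.mul_sum, Finset.sum_range_succ]
        rw [show n + 1 - (n + 1) = 0 from Nat.sub_self _, if_pos rfl, mul_zero, mul_zero, add_zero]
        refine Finset.sum_congr rfl fun k hk => ?_
        have hk' := Finset.mem_range.1 hk
        rw [if_neg (by omega), show n + 1 - k - 1 = n - k by omega]
        ring
  rw [hA, hB, hℓ, add_mul, mul_assoc (C b), sectorMul_add, sectorMul_add]

end SectorMul

/-! ### Norms: Cauchy–Schwarz, `‖X_qA‖² = ‖A‖² + ‖∂_qA‖²`, Euler -/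

section Norms

/-- The Fock inner product as a positive-semidefinite Hermitian core (for Cauchy–Schwarz).
[folklore] -/
@[reducible] def fockCore : PreInnerProductSpace.Core ℂ (MvPolynomial ι ℂ) where
  inner := fockInner
  conj_inner_symm x y := conj_fockInner y x
  re_inner_nonneg x := fockInner_self_re_nonneg x
  add_left x y w := fockInner_add_left x y w
  smul_left x y r := fockInner_smul_left r x y

/-- **Cauchy–Schwarz** for the Fock inner product: `|⟨A, B⟩|² ≤ ‖A‖² ‖B‖²`. [folklore] -/
theorem norm_fockInner_sq_le (A B : MvPolynomial ι ℂ) :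
    ‖fockInner A B‖ ^ 2 ≤ (fockInner A A).re * (fockInner B B).re := by
  letI : PreInnerProductSpace.Core ℂ (MvPolynomial ι ℂ) := fockCore
  have h := InnerProductSpace.Core.inner_mul_inner_self_le (𝕜 := ℂ) (F := MvPolynomial ι ℂ) A B
  change ‖fockInner A B‖ * ‖fockInner B A‖ ≤ (fockInner A A).re * (fockInner B B).re at h
  have hBA : ‖fockInner B A‖ = ‖fockInner A B‖ := by
    rw [← conj_fockInner A B, Complex.norm_conj]
  rw [hBA] at h
  nlinarith [h]

/-- **Cauchy–Schwarz, additive form**: `|⟨A, B⟩| ≤ (‖A‖² + ‖B‖²)/2`. [folklore] -/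
theorem norm_fockInner_le_add_half (A B : MvPolynomial ι ℂ) :
    ‖fockInner A B‖ ≤ ((fockInner A A).re + (fockInner B B).re) / 2 := by
  have h := norm_fockInner_sq_le A B
  have ha := fockInner_self_re_nonneg A
  have hb := fockInner_self_re_nonneg B
  have h2 : ‖fockInner A B‖ ^ 2 ≤ (((fockInner A A).re + (fockInner B B).re) / 2) ^ 2 :=
    h.trans (by nlinarith [sq_nonneg ((fockInner A A).re - (fockInner B B).re)])
  exact (pow_le_pow_iff_left₀ (norm_nonneg _) (by positivity) two_ne_zero).1 h2

/-- `⟨A, A⟩` is real: `⟨A, A⟩ = re⟨A, A⟩`. [folklore] -/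
theorem fockInner_self_eq_re (A : MvPolynomial ι ℂ) : fockInner A A = ((fockInner A A).re : ℂ) := by
  rw [fockInner_self]; norm_cast

/-- Sums in the first argument. [folklore] -/
theorem fockInner_sum_left {κ : Type*} (s : Finset κ) (A : κ → MvPolynomial ι ℂ)
    (B : MvPolynomial ι ℂ) : fockInner (∑ i ∈ s, A i) B = ∑ i ∈ s, fockInner (A i) B := by
  induction s using Finset.cons_induction with
  | empty => simp [fockInner_zero_left]
  | cons a s ha ih => rw [Finset.sum_cons, Finset.sum_cons, fockInner_add_left, ih]

/-- Sums in the second argument. [folklore] -/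
theorem fockInner_sum_right {κ : Type*} (s : Finset κ) (A : MvPolynomial ι ℂ)
    (B : κ → MvPolynomial ι ℂ) : fockInner A (∑ i ∈ s, B i) = ∑ i ∈ s, fockInner A (B i) := by
  induction s using Finset.cons_induction with
  | empty => simp [fockInner_zero_right]
  | cons a s ha ih => rw [Finset.sum_cons, Finset.sum_cons, fockInner_add_right, ih]

/-- `⟨cA, cA⟩ = |c|² ⟨A, A⟩`. [folklore] -/
theorem fockInner_C_mul_self (c : ℂ) (A : MvPolynomial ι ℂ) :
    fockInner (C c * A) (C c * A) = ((‖c‖ ^ 2 : ℝ) : ℂ) * fockInner A A := by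
  rw [← smul_eq_C_mul, fockInner_smul_left, fockInner_smul_right, ← mul_assoc, Complex.conj_mul']
  norm_cast

/-- **`‖∑_{i∈s} Aᵢ‖² ≤ |s| ∑ᵢ ‖Aᵢ‖²`** (from Cauchy–Schwarz pairwise). [folklore] -/
theorem fockInner_sum_self_re_le {κ : Type*} (s : Finset κ) (A : κ → MvPolynomial ι ℂ) :
    (fockInner (∑ i ∈ s, A i) (∑ i ∈ s, A i)).re ≤
      s.card * ∑ i ∈ s, (fockInner (A i) (A i)).re := by
  rw [fockInner_sum_left, Complex.re_sum]
  simp_rw [fockInner_sum_right, Complex.re_sum]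
  calc ∑ i ∈ s, ∑ j ∈ s, (fockInner (A i) (A j)).re
      ≤ ∑ i ∈ s, ∑ j ∈ s, ((fockInner (A i) (A i)).re + (fockInner (A j) (A j)).re) / 2 := by
        refine Finset.sum_le_sum fun i _ => Finset.sum_le_sum fun j _ => ?_
        exact (Complex.re_le_norm _).trans (norm_fockInner_le_add_half _ _)
    _ = s.card * ∑ i ∈ s, (fockInner (A i) (A i)).re := by
        set a : κ → ℝ := fun i => (fockInner (A i) (A i)).re with ha
        change ∑ i ∈ s, ∑ j ∈ s, (a i + a j) / 2 = s.card * ∑ i ∈ s, a i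
        have h1 : ∑ i ∈ s, ∑ j ∈ s, (a i + a j) / 2 =
            ∑ i ∈ s, ∑ j ∈ s, a i / 2 + ∑ i ∈ s, ∑ j ∈ s, a j / 2 := by
          rw [← Finset.sum_add_distrib]
          refine Finset.sum_congr rfl fun i _ => ?_
          rw [← Finset.sum_add_distrib]
          refine Finset.sum_congr rfl fun j _ => ?_
          ring
        rw [h1, Finset.sum_comm (f := fun i j => a j / 2)]
        simp only [Finset.sum_const, nsmul_eq_mul]
        rw [← Finset.mul_sum, ← Finset.sum_div]
        ring

variable [DecidableEq ι]

/-- **`‖X_q A‖² = ‖A‖² + ‖∂_q A‖²`** (from the CCR `∂_q X_q = X_q ∂_q + 1` and adjointness).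
[cite: LSSY2005, App. A (A.7)] -/
theorem fockInner_X_mul_self (q : ι) (A : MvPolynomial ι ℂ) :
    fockInner (X q * A) (X q * A) = fockInner A A + fockInner (pderiv q A) (pderiv q A) := by
  have h1 : fockInner (X q * A) (X q * A) = fockInner A (an q (cr q A)) := by
    rw [← cr_apply, fockInner_cr_left]
  rw [h1, an_cr_apply, if_pos rfl, fockInner_add_right, add_comm]
  congr 1
  rw [← conj_fockInner, fockInner_cr_left, an_apply, fockInner_self_eq_re (pderiv q A),
    Complex.conj_ofReal]

omit [DecidableEq ι] in
/-- **Euler**: `∑_q ‖∂_q A‖² = m ‖A‖²` for `A` homogeneous of degree `m`. [folklore] -/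
theorem sum_fockInner_pderiv_self [Fintype ι] {A : MvPolynomial ι ℂ} {m : ℕ}
    (hA : A.IsHomogeneous m) :
    ∑ q, fockInner (pderiv q A) (pderiv q A) = (m : ℂ) * fockInner A A := by
  have h1 : ∀ q, fockInner (pderiv q A) (pderiv q A) = fockInner (X q * pderiv q A) A := by
    intro q
    rw [← cr_apply, fockInner_cr_left, an_apply]
  simp_rw [h1]
  rw [← fockInner_sum_left, hA.sum_X_mul_pderiv, ← Nat.cast_smul_eq_nsmul ℂ, fockInner_smul_left,
    Complex.conj_natCast]

/-- **`‖X_q A‖² ≤ (m+1) ‖A‖²`** for `A` homogeneous of degree `m`. [folklore] -/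
theorem fockInner_X_mul_self_re_le [Fintype ι] {A : MvPolynomial ι ℂ} {m : ℕ}
    (hA : A.IsHomogeneous m) (q : ι) :
    (fockInner (X q * A) (X q * A)).re ≤ (m + 1) * (fockInner A A).re := by
  rw [fockInner_X_mul_self, Complex.add_re]
  have hsum := congrArg Complex.re (sum_fockInner_pderiv_self hA)
  rw [Complex.re_sum] at hsum
  have hle : (fockInner (pderiv q A) (pderiv q A)).re ≤
      ∑ q', (fockInner (pderiv q' A) (pderiv q' A)).re :=
    Finset.single_le_sum (f := fun q' => (fockInner (pderiv q' A) (pderiv q' A)).re)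
      (fun q' _ => fockInner_self_re_nonneg _) (Finset.mem_univ q)
  rw [hsum] at hle
  have : ((m : ℂ) * fockInner A A).re = m * (fockInner A A).re := by
    rw [show (m : ℂ) = ((m : ℝ) : ℂ) by norm_cast, Complex.re_ofReal_mul]
  rw [this] at hle
  linarith

/-- **`‖X_q^b A‖² ≤ (m+b)^b ‖A‖²`** for `A` homogeneous of degree `m`. [folklore] -/
theorem fockInner_X_pow_mul_self_re_le [Fintype ι] {A : MvPolynomial ι ℂ} {m : ℕ}
    (hA : A.IsHomogeneous m) (q : ι) (b : ℕ) :
    (fockInner (X q ^ b * A) (X q ^ b * A)).re ≤ ((m : ℝ) + b) ^ b * (fockInner A A).re := by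
  induction b with
  | zero => simp
  | succ b ih =>
    have hhom : (X q ^ b * A).IsHomogeneous (m + b) := by
      have := ((isHomogeneous_X (R := ℂ) q).pow b).mul hA
      convert this using 1; ring
    have h1 := fockInner_X_mul_self_re_le hhom q
    rw [pow_succ', mul_assoc]
    push_cast at h1 ⊢
    have h0 := fockInner_self_re_nonneg A
    calc (fockInner (X q * (X q ^ b * A)) (X q * (X q ^ b * A))).re
        ≤ ((m : ℝ) + b + 1) * (fockInner (X q ^ b * A) (X q ^ b * A)).re := h1
      _ ≤ ((m : ℝ) + b + 1) * (((m : ℝ) + b) ^ b * (fockInner A A).re) := by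
          gcongr
      _ = ((m : ℝ) + b + 1) * ((m : ℝ) + b) ^ b * (fockInner A A).re := by ring
      _ ≤ ((m : ℝ) + b + 1) * ((m : ℝ) + (b + 1)) ^ b * (fockInner A A).re := by
          have hp : ((m : ℝ) + b) ^ b ≤ ((m : ℝ) + (b + 1)) ^ b :=
            pow_le_pow_left₀ (by positivity) (by linarith) b
          have hc : (0 : ℝ) ≤ (m : ℝ) + b + 1 := by positivity
          exact mul_le_mul_of_nonneg_right (mul_le_mul_of_nonneg_left hp hc) h0
      _ = ((m : ℝ) + (b + 1)) ^ (b + 1) * (fockInner A A).re := by ring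

/-- **`‖X^d A‖² ≤ (m + |d|)^{|d|} ‖A‖²`** for `A` homogeneous of degree `m`. [folklore] -/
theorem fockInner_monomial_mul_self_re_le [Fintype ι] (d : ι →₀ ℕ) {A : MvPolynomial ι ℂ}
    {m : ℕ} (hA : A.IsHomogeneous m) :
    (fockInner (monomial d 1 * A) (monomial d 1 * A)).re ≤
      ((m : ℝ) + d.degree) ^ d.degree * (fockInner A A).re := by
  induction d using Finsupp.induction generalizing A m with
  | zero => simp
  | single_add a b f ha hb ih =>
    rw [monomial_single_add, mul_assoc, map_add, Finsupp.degree_single]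
    have hhom : (monomial f (1 : ℂ) * A).IsHomogeneous (m + f.degree) := by
      have := (isHomogeneous_monomial (R := ℂ) (d := f) 1 rfl).mul hA
      convert this using 1; ring
    have h1 := fockInner_X_pow_mul_self_re_le hhom a b
    have h2 := ih hA
    have h0 := fockInner_self_re_nonneg A
    push_cast at h1 h2 ⊢
    calc (fockInner (X a ^ b * (monomial f 1 * A)) (X a ^ b * (monomial f 1 * A))).re
        ≤ ((m : ℝ) + f.degree + b) ^ b * (fockInner (monomial f 1 * A) (monomial f 1 * A)).re := h1
      _ ≤ ((m : ℝ) + f.degree + b) ^ b * (((m : ℝ) + f.degree) ^ f.degree * (fockInner A A).re) := by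
          gcongr
      _ = ((m : ℝ) + (b + f.degree)) ^ b * ((m : ℝ) + f.degree) ^ f.degree * (fockInner A A).re := by
          ring
      _ ≤ ((m : ℝ) + (b + f.degree)) ^ b * ((m : ℝ) + (b + f.degree)) ^ f.degree *
            (fockInner A A).re := by
          have hp : ((m : ℝ) + f.degree) ^ f.degree ≤ ((m : ℝ) + (b + f.degree)) ^ f.degree :=
            pow_le_pow_left₀ (by positivity) (by linarith) _
          have hc : (0 : ℝ) ≤ ((m : ℝ) + (b + f.degree)) ^ b := by positivity
          exact mul_le_mul_of_nonneg_right (mul_le_mul_of_nonneg_left hp hc) h0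
      _ = ((m : ℝ) + (b + f.degree)) ^ (b + f.degree) * (fockInner A A).re := by
          rw [pow_add]

end Norms

/-! ### LEMMA A, first half: exponential decay of `‖Γ_m‖²` (Euler recursion) -/

section Decay

variable [Fintype ι] [DecidableEq ι] {z : ι} {σ : ι → ι} {P : Finset ι} {N₀ : ℝ} {t : ι → ℝ}

omit [DecidableEq ι] in
/-- Euler, real form: `∑_q ‖∂_qA‖² = m‖A‖²`. [folklore] -/
theorem sum_fockInner_pderiv_self_re {A : MvPolynomial ι ℂ} {m : ℕ} (hA : A.IsHomogeneous m) :
    ∑ q, (fockInner (pderiv q A) (pderiv q A)).re = (m : ℝ) * (fockInner A A).re := by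
  have h := congrArg Complex.re (sum_fockInner_pderiv_self hA)
  rw [Complex.re_sum, show ((m : ℕ) : ℂ) = (((m : ℝ)) : ℂ) by push_cast; ring,
    Complex.re_ofReal_mul] at h
  exact h

omit [Fintype ι] in
/-- LEMMA B two degrees up: `∂_qΓ_{m+2} = √N₀[q=z]Γ_{m+1} + t̃_qX_{σq}Γ_m`. [folklore] -/
theorem pderiv_gaussSector_add_two (hσ : Function.Involutive σ) (hP : ∀ p ∈ P, σ p ∉ P) (q : ι)
    (m : ℕ) :
    pderiv q (gaussSector z σ P N₀ t (m + 2)) =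
      C (((if q = z then Real.sqrt N₀ else 0 : ℝ) : ℂ)) * gaussSector z σ P N₀ t (m + 1) +
        C ((pairCoeff σ P t q : ℝ) : ℂ) * X (σ q) * gaussSector z σ P N₀ t m := by
  have h := pderiv_gaussSector_succ (z := z) (N₀ := N₀) (t := t) hσ hP q (m + 1)
  rw [if_neg (Nat.succ_ne_zero m), Nat.add_sub_cancel] at h
  exact h

omit [Fintype ι] in
/-- `‖∂_zΓ_{m+2}‖² = N₀‖Γ_{m+1}‖²` (the condensate mode). [folklore] -/
theorem fockInner_pderiv_z_gaussSector (hσ : Function.Involutive σ) (hσz : σ z = z)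
    (hP : ∀ p ∈ P, σ p ∉ P) (hN₀ : 0 ≤ N₀) (m : ℕ) :
    (fockInner (pderiv z (gaussSector z σ P N₀ t (m + 2)))
        (pderiv z (gaussSector z σ P N₀ t (m + 2)))).re =
      N₀ * (fockInner (gaussSector z σ P N₀ t (m + 1)) (gaussSector z σ P N₀ t (m + 1))).re := by
  rw [pderiv_gaussSector_add_two hσ hP z m, if_pos rfl, pairCoeff_z hP hσz]
  simp only [Complex.ofReal_zero, C_0, zero_mul, add_zero]
  rw [fockInner_C_mul_self, Complex.re_ofReal_mul, Complex.norm_real, Real.norm_eq_abs,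
    sq_abs, Real.sq_sqrt hN₀]

omit [Fintype ι] in
/-- `‖∂_qΓ_{m+2}‖² = t̃_q²(‖Γ_m‖² + ‖∂_{σq}Γ_m‖²)` for `q ≠ z`. [folklore] -/
theorem fockInner_pderiv_ne_gaussSector (hσ : Function.Involutive σ) (hP : ∀ p ∈ P, σ p ∉ P)
    {q : ι} (hqz : q ≠ z) (m : ℕ) :
    (fockInner (pderiv q (gaussSector z σ P N₀ t (m + 2)))
        (pderiv q (gaussSector z σ P N₀ t (m + 2)))).re =
      pairCoeff σ P t q ^ 2 *
        ((fockInner (gaussSector z σ P N₀ t m) (gaussSector z σ P N₀ t m)).re +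
          (fockInner (pderiv (σ q) (gaussSector z σ P N₀ t m))
            (pderiv (σ q) (gaussSector z σ P N₀ t m))).re) := by
  rw [pderiv_gaussSector_add_two hσ hP q m, if_neg hqz]
  simp only [Complex.ofReal_zero, C_0, zero_mul, zero_add]
  rw [mul_assoc, fockInner_C_mul_self, Complex.re_ofReal_mul, Complex.norm_real, Real.norm_eq_abs,
    sq_abs, fockInner_X_mul_self, Complex.add_re]

/-- **The norm recursion**
`(m+2)‖Γ_{m+2}‖² ≤ N₀‖Γ_{m+1}‖² + (∑_q t̃_q² + θ m)‖Γ_m‖²` (`t̃_q² ≤ θ`): Euler's identity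
`(m+2)‖Γ_{m+2}‖² = ∑_q ‖∂_qΓ_{m+2}‖²`, LEMMA B, `‖X_{σq}Γ_m‖² = ‖Γ_m‖² + ‖∂_{σq}Γ_m‖²` and Euler
again. [folklore] -/
theorem gaussSector_norm_recursion (hσ : Function.Involutive σ) (hσz : σ z = z)
    (hP : ∀ p ∈ P, σ p ∉ P) (hN₀ : 0 ≤ N₀) {θ : ℝ} (hθ : ∀ q, pairCoeff σ P t q ^ 2 ≤ θ) (m : ℕ) :
    ((m : ℝ) + 2) *
        (fockInner (gaussSector z σ P N₀ t (m + 2)) (gaussSector z σ P N₀ t (m + 2))).re ≤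
      N₀ * (fockInner (gaussSector z σ P N₀ t (m + 1)) (gaussSector z σ P N₀ t (m + 1))).re +
        ((∑ q, pairCoeff σ P t q ^ 2) + θ * m) *
          (fockInner (gaussSector z σ P N₀ t m) (gaussSector z σ P N₀ t m)).re := by
  have hθ0 : 0 ≤ θ := (sq_nonneg _).trans (hθ z)
  have hE2 := sum_fockInner_pderiv_self_re (isHomogeneous_gaussSector (z := z) (σ := σ) (P := P)
    (N₀ := N₀) (t := t) (m + 2))
  have hE0 := sum_fockInner_pderiv_self_re (isHomogeneous_gaussSector (z := z) (σ := σ) (P := P)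
    (N₀ := N₀) (t := t) m)
  push_cast at hE2
  rw [← hE2, ← Finset.add_sum_erase _ _ (Finset.mem_univ z),
    fockInner_pderiv_z_gaussSector hσ hσz hP hN₀ m]
  have hM0 := fockInner_self_re_nonneg (gaussSector z σ P N₀ t m)
  have hD0 : ∀ q, 0 ≤ (fockInner (pderiv q (gaussSector z σ P N₀ t m))
      (pderiv q (gaussSector z σ P N₀ t m))).re := fun q => fockInner_self_re_nonneg _
  have hrest : ∑ q ∈ Finset.univ.erase z, (fockInner (pderiv q (gaussSector z σ P N₀ t (m + 2)))
      (pderiv q (gaussSector z σ P N₀ t (m + 2)))).re ≤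
      (∑ q, pairCoeff σ P t q ^ 2) *
          (fockInner (gaussSector z σ P N₀ t m) (gaussSector z σ P N₀ t m)).re +
        θ * ∑ q, (fockInner (pderiv q (gaussSector z σ P N₀ t m))
          (pderiv q (gaussSector z σ P N₀ t m))).re := by
    rw [Finset.sum_congr rfl fun q hq' =>
      fockInner_pderiv_ne_gaussSector (N₀ := N₀) (t := t) hσ hP (Finset.ne_of_mem_erase hq') m]
    rw [← Equiv.sum_comp hσ.toPerm (fun q => (fockInner (pderiv q (gaussSector z σ P N₀ t m))
      (pderiv q (gaussSector z σ P N₀ t m))).re)]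
    simp only [Function.Involutive.coe_toPerm]
    rw [Finset.sum_mul, Finset.mul_sum, ← Finset.sum_add_distrib]
    calc ∑ q ∈ Finset.univ.erase z, pairCoeff σ P t q ^ 2 *
          ((fockInner (gaussSector z σ P N₀ t m) (gaussSector z σ P N₀ t m)).re +
            (fockInner (pderiv (σ q) (gaussSector z σ P N₀ t m))
              (pderiv (σ q) (gaussSector z σ P N₀ t m))).re)
        ≤ ∑ q ∈ Finset.univ.erase z, (pairCoeff σ P t q ^ 2 *
            (fockInner (gaussSector z σ P N₀ t m) (gaussSector z σ P N₀ t m)).re +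
            θ * (fockInner (pderiv (σ q) (gaussSector z σ P N₀ t m))
              (pderiv (σ q) (gaussSector z σ P N₀ t m))).re) := by
          refine Finset.sum_le_sum fun q _ => ?_
          rw [mul_add]
          have h1 := hD0 (σ q)
          have h2 := hθ q
          nlinarith
      _ ≤ ∑ q, (pairCoeff σ P t q ^ 2 *
            (fockInner (gaussSector z σ P N₀ t m) (gaussSector z σ P N₀ t m)).re +
            θ * (fockInner (pderiv (σ q) (gaussSector z σ P N₀ t m))
              (pderiv (σ q) (gaussSector z σ P N₀ t m))).re) :=
          Finset.sum_le_univ_sum_of_nonneg fun q => by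
            have h1 := hD0 (σ q); positivity
  rw [hE0] at hrest
  nlinarith [hrest]

omit [Fintype ι] [DecidableEq ι] in
/-- **From the recursion to exponential decay** (elementary): if `M ≥ 0` satisfies
`(m+2)M_{m+2} ≤ N₀M_{m+1} + (τ + θm)M_m` with `N₀, τ ≥ 0`, `0 ≤ θ < 1`, then `M_m ≤ A r^m` with
`r = (1+θ)/2 < 1`. [folklore] -/
theorem decay_of_norm_recursion (M : ℕ → ℝ) (hM0 : ∀ k, 0 ≤ M k) {N₀ τ θ : ℝ} (hN₀ : 0 ≤ N₀)
    (hτ0 : 0 ≤ τ) (hθ0 : 0 ≤ θ) (hθ1 : θ < 1)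
    (hrec : ∀ m : ℕ, ((m : ℝ) + 2) * M (m + 2) ≤ N₀ * M (m + 1) + (τ + θ * m) * M m) :
    ∃ A r : ℝ, 0 < A ∧ 0 < r ∧ r < 1 ∧ ∀ m, M m ≤ A * r ^ m := by
  set r : ℝ := (1 + θ) / 2 with hr
  have hr0 : 0 < r := by rw [hr]; linarith
  have hr1 : r < 1 := by rw [hr]; linarith
  have hgap : 0 < r ^ 2 - θ := by rw [hr]; nlinarith
  set Λ : ℝ := N₀ * r + τ with hΛ
  have hΛ0 : 0 ≤ Λ := by positivity
  set m₀ : ℕ := ⌈Λ / (r ^ 2 - θ)⌉₊ with hm₀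
  have hm₀' : ∀ n : ℕ, m₀ ≤ n → Λ ≤ n * (r ^ 2 - θ) := by
    intro n hn
    have h1 : Λ / (r ^ 2 - θ) ≤ n := (Nat.le_ceil _).trans (by exact_mod_cast hn)
    rwa [div_le_iff₀ hgap] at h1
  set A : ℝ := (∑ j ∈ range (m₀ + 2), M j / r ^ j) + 1 with hA
  have hA0 : 0 < A := by
    have : 0 ≤ ∑ j ∈ range (m₀ + 2), M j / r ^ j := Finset.sum_nonneg fun j _ => by
      have := hM0 j; positivity
    rw [hA]; linarith
  have hbase : ∀ j, j < m₀ + 2 → M j ≤ A * r ^ j := by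
    intro j hj
    have h1 : M j / r ^ j ≤ ∑ i ∈ range (m₀ + 2), M i / r ^ i :=
      Finset.single_le_sum (f := fun i => M i / r ^ i) (fun i _ => by have := hM0 i; positivity)
        (Finset.mem_range.2 hj)
    have hrj : 0 < r ^ j := pow_pos hr0 j
    rw [div_le_iff₀ hrj] at h1
    nlinarith [hrj]
  refine ⟨A, r, hA0, hr0, hr1, fun m => ?_⟩
  induction m using Nat.strong_induction_on with
  | _ m ih =>
    by_cases hm : m < m₀ + 2
    · exact hbase m hm
    · obtain ⟨n, rfl⟩ : ∃ n, m = n + 2 := ⟨m - 2, by omega⟩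
      have hn : m₀ ≤ n := by omega
      have h1 := ih (n + 1) (by omega)
      have h0 := ih n (by omega)
      have hrecn := hrec n
      have hcoef : 0 ≤ τ + θ * n := by positivity
      have hrn : 0 < r ^ n := pow_pos hr0 n
      have hΛn := hm₀' n hn
      have h2 : ((n : ℝ) + 2) * M (n + 2) ≤ A * r ^ n * (N₀ * r + (τ + θ * n)) := by
        calc ((n : ℝ) + 2) * M (n + 2) ≤ N₀ * M (n + 1) + (τ + θ * n) * M n := hrecn
          _ ≤ N₀ * (A * r ^ (n + 1)) + (τ + θ * n) * (A * r ^ n) := by gcongr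
          _ = A * r ^ n * (N₀ * r + (τ + θ * n)) := by ring
      have h3 : N₀ * r + (τ + θ * n) ≤ ((n : ℝ) + 2) * r ^ 2 := by
        nlinarith [hΛn, hgap, hθ0, sq_nonneg r]
      have h4 : ((n : ℝ) + 2) * M (n + 2) ≤ ((n : ℝ) + 2) * (A * r ^ (n + 2)) := by
        calc ((n : ℝ) + 2) * M (n + 2) ≤ A * r ^ n * (N₀ * r + (τ + θ * n)) := h2
          _ ≤ A * r ^ n * (((n : ℝ) + 2) * r ^ 2) := by gcongr
          _ = ((n : ℝ) + 2) * (A * r ^ (n + 2)) := by ring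
      exact le_of_mul_le_mul_left h4 (by positivity)

/-- **LEMMA A (core): exponential decay `‖Γ_m‖² ≤ A r^m`, `0 < r < 1`,** whenever `N₀ ≥ 0` and all
pair amplitudes satisfy `|t_p| < 1` (equivalently: the Gaussian vector `Γ = ∑ Γ_m` has finite Fock
norm together with all polynomial moments — the analytic content of "`T_ν` and `W(N₀)` are unitary").
[folklore] -/
theorem gaussSector_norm_decay (hσ : Function.Involutive σ) (hσz : σ z = z) (hP : ∀ p ∈ P, σ p ∉ P)
    (hN₀ : 0 ≤ N₀) (ht : ∀ p ∈ P, |t p| < 1) :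
    ∃ A r : ℝ, 0 < A ∧ 0 < r ∧ r < 1 ∧ ∀ m,
      (fockInner (gaussSector z σ P N₀ t m) (gaussSector z σ P N₀ t m)).re ≤ A * r ^ m := by
  have hne : (Finset.univ : Finset ι).Nonempty := ⟨z, Finset.mem_univ z⟩
  obtain ⟨θ, hθq, hθ0, hθ1⟩ : ∃ θ : ℝ, (∀ q, pairCoeff σ P t q ^ 2 ≤ θ) ∧ 0 ≤ θ ∧ θ < 1 := by
    refine ⟨Finset.univ.sup' hne (fun q => pairCoeff σ P t q ^ 2),
      fun q => Finset.le_sup' (fun q => pairCoeff σ P t q ^ 2) (Finset.mem_univ q), ?_, ?_⟩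
    · exact (sq_nonneg _).trans (Finset.le_sup' (fun q => pairCoeff σ P t q ^ 2) (Finset.mem_univ z))
    · rw [Finset.sup'_lt_iff]
      intro q _
      have h := abs_pairCoeff_lt_one (σ := σ) (P := P) (t := t) ht q
      have h0 := abs_nonneg (pairCoeff σ P t q)
      rw [← sq_abs]
      nlinarith
  refine decay_of_norm_recursion (fun m => (fockInner (gaussSector z σ P N₀ t m)
    (gaussSector z σ P N₀ t m)).re) (fun k => fockInner_self_re_nonneg _) hN₀
    (τ := ∑ q, pairCoeff σ P t q ^ 2)
    (Finset.sum_nonneg fun q _ => sq_nonneg (pairCoeff σ P t q)) hθ0 hθ1 fun m => ?_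
  exact gaussSector_norm_recursion hσ hσz hP hN₀ hθq m

/-! ### LEMMA A, second half: the sectors `(QΓ)_m` decay, hence all Gaussian-picture inner
products converge absolutely -/

omit [Fintype ι] [DecidableEq ι] in
/-- The homogeneous components have support in the support and the same coefficients there.
[folklore] -/
theorem sum_norm_coeff_homogeneousComponent_le (Q : MvPolynomial ι ℂ) (k : ℕ) :
    ((homogeneousComponent k Q).support.card : ℝ) *
        ∑ e ∈ (homogeneousComponent k Q).support, ‖coeff e (homogeneousComponent k Q)‖ ^ 2 ≤
      (Q.support.card : ℝ) * ∑ e ∈ Q.support, ‖coeff e Q‖ ^ 2 := by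
  have hsub : (homogeneousComponent k Q).support ⊆ Q.support := by
    intro e he
    rw [MvPolynomial.mem_support_iff, coeff_homogeneousComponent] at he
    rw [MvPolynomial.mem_support_iff]
    intro h; apply he; simp [h]
  have hcoeff : ∀ e ∈ (homogeneousComponent k Q).support,
      ‖coeff e (homogeneousComponent k Q)‖ ^ 2 = ‖coeff e Q‖ ^ 2 := by
    intro e he
    rw [MvPolynomial.mem_support_iff, coeff_homogeneousComponent] at he
    rw [coeff_homogeneousComponent]
    split_ifs with h
    · rfl
    · exact absurd (by simp [h] : (if e.degree = k then coeff e Q else 0) = 0) he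
  rw [Finset.sum_congr rfl hcoeff]
  exact mul_le_mul (by exact_mod_cast Finset.card_le_card hsub)
    (Finset.sum_le_sum_of_subset_of_nonneg hsub fun _ _ _ => by positivity)
    (Finset.sum_nonneg fun _ _ => by positivity) (by positivity)

/-- **`‖Q_k Γ_j‖² ≤ |supp Q| (∑_e |Q_e|²) (j+k)^k ‖Γ_j‖²`** (monomial expansion of `Q_k`, the
sum bound and `‖X^eΓ_j‖² ≤ (j+|e|)^{|e|}‖Γ_j‖²`). [folklore] -/
theorem fockInner_homogeneousComponent_mul_self_re_le (Q : MvPolynomial ι ℂ) (k : ℕ)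
    {G : MvPolynomial ι ℂ} {j : ℕ} (hG : G.IsHomogeneous j) :
    (fockInner (homogeneousComponent k Q * G) (homogeneousComponent k Q * G)).re ≤
      (Q.support.card : ℝ) * (∑ e ∈ Q.support, ‖coeff e Q‖ ^ 2) * ((j : ℝ) + k) ^ k *
        (fockInner G G).re := by
  set R := homogeneousComponent k Q with hR
  have hexp : R * G = ∑ e ∈ R.support, monomial e (coeff e R) * G := by
    conv_lhs => rw [R.as_sum]
    rw [Finset.sum_mul]
  have h1 := fockInner_sum_self_re_le R.support (fun e => monomial e (coeff e R) * G)
  rw [← hexp] at h1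
  have hterm : ∀ e ∈ R.support, (fockInner (monomial e (coeff e R) * G) (monomial e (coeff e R) * G)).re
      ≤ ‖coeff e R‖ ^ 2 * (((j : ℝ) + k) ^ k * (fockInner G G).re) := by
    intro e he
    have hdeg : e.degree = k := by
      rw [MvPolynomial.mem_support_iff, hR, coeff_homogeneousComponent] at he
      by_contra h; exact he (if_neg h)
    have hmon : monomial e (coeff e R) * G = C (coeff e R) * (monomial e 1 * G) := by
      rw [← mul_assoc, C_mul_monomial, mul_one]
    rw [hmon, fockInner_C_mul_self, Complex.re_ofReal_mul]
    have h2 := fockInner_monomial_mul_self_re_le e hG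
    rw [hdeg] at h2
    exact mul_le_mul_of_nonneg_left h2 (sq_nonneg _)
  have h0 := fockInner_self_re_nonneg G
  calc (fockInner (R * G) (R * G)).re
      ≤ R.support.card * ∑ e ∈ R.support,
          (fockInner (monomial e (coeff e R) * G) (monomial e (coeff e R) * G)).re := h1
    _ ≤ R.support.card * ∑ e ∈ R.support, ‖coeff e R‖ ^ 2 * (((j : ℝ) + k) ^ k * (fockInner G G).re) := by
        gcongr with e he
        exact hterm e he
    _ = (R.support.card * ∑ e ∈ R.support, ‖coeff e R‖ ^ 2) * (((j : ℝ) + k) ^ k * (fockInner G G).re) := by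
        rw [← Finset.sum_mul]; ring
    _ ≤ (Q.support.card * ∑ e ∈ Q.support, ‖coeff e Q‖ ^ 2) * (((j : ℝ) + k) ^ k * (fockInner G G).re) := by
        apply mul_le_mul_of_nonneg_right (sum_norm_coeff_homogeneousComponent_le Q k)
        positivity
    _ = _ := by ring

/-- **LEMMA A: `‖(QΓ)_m‖² ≤ C_Q (m+1)^{deg Q + 1} r^m`** with the rate `r < 1` of
`gaussSector_norm_decay`. [folklore] -/
theorem sectorMul_norm_le (hσ : Function.Involutive σ) (hσz : σ z = z) (hP : ∀ p ∈ P, σ p ∉ P)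
    (hN₀ : 0 ≤ N₀) (ht : ∀ p ∈ P, |t p| < 1) (Q : MvPolynomial ι ℂ) :
    ∃ Cq r : ℝ, 0 ≤ Cq ∧ 0 < r ∧ r < 1 ∧ ∀ m,
      (fockInner (sectorMul z σ P N₀ t Q m) (sectorMul z σ P N₀ t Q m)).re ≤
        Cq * ((m : ℝ) + 1) ^ (Q.totalDegree + 1) * r ^ m := by
  obtain ⟨A, r, hA, hr0, hr1, hM⟩ := gaussSector_norm_decay (z := z) (N₀ := N₀) (t := t) hσ hσz hP hN₀ ht
  set K : ℕ := Q.totalDegree with hK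
  set BQ : ℝ := (Q.support.card : ℝ) * ∑ e ∈ Q.support, ‖coeff e Q‖ ^ 2 with hBQ
  have hBQ0 : 0 ≤ BQ := by positivity
  refine ⟨BQ * A * (K + 1) / r ^ K, r, by positivity, hr0, hr1, fun m => ?_⟩
  have hrK : 0 < r ^ K := pow_pos hr0 K
  -- the sum bound over `k ∈ range (m+1)`
  have h1 := fockInner_sum_self_re_le (range (m + 1))
    (fun k => homogeneousComponent k Q * gaussSector z σ P N₀ t (m - k))
  rw [Finset.card_range] at h1
  change (fockInner (sectorMul z σ P N₀ t Q m) (sectorMul z σ P N₀ t Q m)).re ≤ _ at h1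
  -- each term
  have hterm : ∀ k ∈ range (m + 1),
      (fockInner (homogeneousComponent k Q * gaussSector z σ P N₀ t (m - k))
        (homogeneousComponent k Q * gaussSector z σ P N₀ t (m - k))).re ≤
      if k ≤ K then BQ * ((m : ℝ) + 1) ^ K * (A * (r ^ m / r ^ K)) else 0 := by
    intro k hk
    have hkm : k ≤ m := Nat.lt_succ_iff.1 (Finset.mem_range.1 hk)
    by_cases hkK : k ≤ K
    · rw [if_pos hkK]
      have h2 := fockInner_homogeneousComponent_mul_self_re_le Q k
        (isHomogeneous_gaussSector (z := z) (σ := σ) (P := P) (N₀ := N₀) (t := t) (m - k))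
      refine h2.trans ?_
      have hjk : ((m - k : ℕ) : ℝ) + k = m := by
        rw [Nat.cast_sub hkm]; ring
      rw [hjk]
      have hmk : (m : ℝ) ^ k ≤ ((m : ℝ) + 1) ^ K := by
        calc (m : ℝ) ^ k ≤ ((m : ℝ) + 1) ^ k := pow_le_pow_left₀ (by positivity) (by linarith) k
          _ ≤ ((m : ℝ) + 1) ^ K := pow_le_pow_right₀ (by linarith [Nat.cast_nonneg (α := ℝ) m]) hkK
      have hrmk : r ^ (m - k) ≤ r ^ m / r ^ K := by
        rw [le_div_iff₀ hrK, ← pow_add]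
        exact pow_le_pow_of_le_one hr0.le hr1.le (by omega)
      have hMmk := hM (m - k)
      have hG0 := fockInner_self_re_nonneg (gaussSector z σ P N₀ t (m - k))
      calc BQ * (m : ℝ) ^ k * (fockInner (gaussSector z σ P N₀ t (m - k)) (gaussSector z σ P N₀ t (m - k))).re
          ≤ BQ * ((m : ℝ) + 1) ^ K * (A * r ^ (m - k)) := by gcongr
        _ ≤ BQ * ((m : ℝ) + 1) ^ K * (A * (r ^ m / r ^ K)) := by gcongr
    · rw [if_neg hkK]
      have hzero : homogeneousComponent k Q = 0 :=
        homogeneousComponent_eq_zero _ _ (by omega)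
      rw [hzero, zero_mul, fockInner_zero_left, Complex.zero_re]
  have hsum : ∑ k ∈ range (m + 1),
      (fockInner (homogeneousComponent k Q * gaussSector z σ P N₀ t (m - k))
        (homogeneousComponent k Q * gaussSector z σ P N₀ t (m - k))).re ≤
      (K + 1) * (BQ * ((m : ℝ) + 1) ^ K * (A * (r ^ m / r ^ K))) := by
    calc ∑ k ∈ range (m + 1),
        (fockInner (homogeneousComponent k Q * gaussSector z σ P N₀ t (m - k))
          (homogeneousComponent k Q * gaussSector z σ P N₀ t (m - k))).re
        ≤ ∑ k ∈ range (m + 1), (if k ≤ K then BQ * ((m : ℝ) + 1) ^ K * (A * (r ^ m / r ^ K)) else 0) :=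
          Finset.sum_le_sum hterm
      _ = ((range (m + 1)).filter (fun k => k ≤ K)).card * (BQ * ((m : ℝ) + 1) ^ K * (A * (r ^ m / r ^ K))) := by
          rw [Finset.sum_ite, Finset.sum_const_zero, add_zero, Finset.sum_const, nsmul_eq_mul]
      _ ≤ (K + 1) * (BQ * ((m : ℝ) + 1) ^ K * (A * (r ^ m / r ^ K))) := by
          gcongr
          have : ((range (m + 1)).filter (fun k => k ≤ K)) ⊆ range (K + 1) := by
            intro k hk
            rw [Finset.mem_filter] at hk
            exact Finset.mem_range.2 (by omega)
          have := Finset.card_le_card this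
          rw [Finset.card_range] at this
          exact_mod_cast this
  calc (fockInner (sectorMul z σ P N₀ t Q m) (sectorMul z σ P N₀ t Q m)).re
      ≤ (m + 1 : ℕ) * ∑ k ∈ range (m + 1),
          (fockInner (homogeneousComponent k Q * gaussSector z σ P N₀ t (m - k))
            (homogeneousComponent k Q * gaussSector z σ P N₀ t (m - k))).re := h1
    _ ≤ (m + 1 : ℕ) * ((K + 1) * (BQ * ((m : ℝ) + 1) ^ K * (A * (r ^ m / r ^ K)))) := by
        gcongr
    _ = BQ * A * (K + 1) / r ^ K * ((m : ℝ) + 1) ^ (K + 1) * r ^ m := by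
        push_cast
        field_simp
        ring

/-- **LEMMA A (summability): the Gaussian-picture inner products `∑_m ⟨(QΓ)_m, (Q'Γ)_m⟩`
converge absolutely** for all polynomials `Q, Q'`. [folklore] -/
theorem summable_norm_fockInner_sectorMul (hσ : Function.Involutive σ) (hσz : σ z = z)
    (hP : ∀ p ∈ P, σ p ∉ P) (hN₀ : 0 ≤ N₀) (ht : ∀ p ∈ P, |t p| < 1) (Q Q' : MvPolynomial ι ℂ) :
    Summable fun m => ‖fockInner (sectorMul z σ P N₀ t Q m) (sectorMul z σ P N₀ t Q' m)‖ := by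
  obtain ⟨C, r, hC, hr0, hr1, hQ⟩ := sectorMul_norm_le (z := z) (N₀ := N₀) (t := t) hσ hσz hP hN₀ ht Q
  obtain ⟨C', r', hC', hr0', hr1', hQ'⟩ := sectorMul_norm_le (z := z) (N₀ := N₀) (t := t) hσ hσz hP hN₀ ht Q'
  -- summable majorants `C (m+1)^K r^m`
  have hmaj : ∀ (C r : ℝ) (K : ℕ), 0 < r → r < 1 →
      Summable fun m : ℕ => C * ((m : ℝ) + 1) ^ K * r ^ m := by
    intro C r K hr0 hr1
    have h := summable_pow_mul_geometric_of_norm_lt_one K (r := r) (by rwa [Real.norm_of_nonneg hr0.le])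
    have h1 : Summable fun m : ℕ => ((m + 1 : ℕ) : ℝ) ^ K * r ^ (m + 1) :=
      (summable_nat_add_iff 1).2 h
    have h2 : Summable fun m : ℕ => C * r⁻¹ * (((m + 1 : ℕ) : ℝ) ^ K * r ^ (m + 1)) := h1.mul_left _
    convert h2 using 1
    funext m
    push_cast
    field_simp
    ring
  have hbound : ∀ m, ‖fockInner (sectorMul z σ P N₀ t Q m) (sectorMul z σ P N₀ t Q' m)‖ ≤
      (C * ((m : ℝ) + 1) ^ (Q.totalDegree + 1) * r ^ m +
        C' * ((m : ℝ) + 1) ^ (Q'.totalDegree + 1) * r' ^ m) / 2 := fun m =>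
    (norm_fockInner_le_add_half _ _).trans
      (div_le_div_of_nonneg_right (add_le_add (hQ m) (hQ' m)) (by norm_num))
  exact Summable.of_nonneg_of_le (fun m => norm_nonneg _) hbound
    (((hmaj C r _ hr0 hr1).add (hmaj C' r' _ hr0' hr1')).div_const 2)

end Decay

/-! ### The Gaussian-picture inner product `⟪Q, Q'⟫_Γ = ⟨QΓ, Q'Γ⟩` and LEMMA C (adjointness) -/

/-- The **Gaussian-picture inner product** `⟪Q, Q'⟫_Γ = ⟨QΓ, Q'Γ⟩_Fock = ∑_m ⟨(QΓ)_m, (Q'Γ)_m⟩`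
of two finite-excitation vectors `Q, Q'` dressed by the Gaussian vector `Γ` (an absolutely
convergent series by LEMMA A). With `Q = 𝒯ξ` (`𝒯` the Bogoliubov–Weyl map of the sequel) this
is the Fock inner product of the trial vectors `W(N₀)T_νξ`. [folklore] -/
def gaussInner [DecidableEq ι] (z : ι) (σ : ι → ι) (P : Finset ι) (N₀ : ℝ) (t : ι → ℝ)
    (Q Q' : MvPolynomial ι ℂ) : ℂ :=
  ∑' m, fockInner (sectorMul z σ P N₀ t Q m) (sectorMul z σ P N₀ t Q' m)

section GaussInner

variable [Fintype ι] [DecidableEq ι] {z : ι} {σ : ι → ι} {P : Finset ι} {N₀ : ℝ} {t : ι → ℝ}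

/-- The defining series converges. [folklore] -/
theorem summable_fockInner_sectorMul (hσ : Function.Involutive σ) (hσz : σ z = z)
    (hP : ∀ p ∈ P, σ p ∉ P) (hN₀ : 0 ≤ N₀) (ht : ∀ p ∈ P, |t p| < 1) (Q Q' : MvPolynomial ι ℂ) :
    Summable fun m => fockInner (sectorMul z σ P N₀ t Q m) (sectorMul z σ P N₀ t Q' m) :=
  (summable_norm_fockInner_sectorMul hσ hσz hP hN₀ ht Q Q').of_norm

/-- `⟪Q, Q'⟫_Γ` is the sum of its defining series. [folklore] -/
theorem hasSum_gaussInner (hσ : Function.Involutive σ) (hσz : σ z = z)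
    (hP : ∀ p ∈ P, σ p ∉ P) (hN₀ : 0 ≤ N₀) (ht : ∀ p ∈ P, |t p| < 1) (Q Q' : MvPolynomial ι ℂ) :
    HasSum (fun m => fockInner (sectorMul z σ P N₀ t Q m) (sectorMul z σ P N₀ t Q' m))
      (gaussInner z σ P N₀ t Q Q') :=
  (summable_fockInner_sectorMul hσ hσz hP hN₀ ht Q Q').hasSum

/-- Additivity of `⟪·, ·⟫_Γ` in the first argument. [folklore] -/
theorem gaussInner_add_left (hσ : Function.Involutive σ) (hσz : σ z = z)
    (hP : ∀ p ∈ P, σ p ∉ P) (hN₀ : 0 ≤ N₀) (ht : ∀ p ∈ P, |t p| < 1)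
    (Q₁ Q₂ Q' : MvPolynomial ι ℂ) :
    gaussInner z σ P N₀ t (Q₁ + Q₂) Q' = gaussInner z σ P N₀ t Q₁ Q' + gaussInner z σ P N₀ t Q₂ Q' := by
  unfold gaussInner
  rw [← (summable_fockInner_sectorMul hσ hσz hP hN₀ ht Q₁ Q').tsum_add
    (summable_fockInner_sectorMul hσ hσz hP hN₀ ht Q₂ Q')]
  refine tsum_congr fun m => ?_
  rw [sectorMul_add, fockInner_add_left]

/-- Additivity of `⟪·, ·⟫_Γ` in the second argument. [folklore] -/
theorem gaussInner_add_right (hσ : Function.Involutive σ) (hσz : σ z = z)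
    (hP : ∀ p ∈ P, σ p ∉ P) (hN₀ : 0 ≤ N₀) (ht : ∀ p ∈ P, |t p| < 1)
    (Q Q₁ Q₂ : MvPolynomial ι ℂ) :
    gaussInner z σ P N₀ t Q (Q₁ + Q₂) = gaussInner z σ P N₀ t Q Q₁ + gaussInner z σ P N₀ t Q Q₂ := by
  unfold gaussInner
  rw [← (summable_fockInner_sectorMul hσ hσz hP hN₀ ht Q Q₁).tsum_add
    (summable_fockInner_sectorMul hσ hσz hP hN₀ ht Q Q₂)]
  refine tsum_congr fun m => ?_
  rw [sectorMul_add, fockInner_add_right]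

omit [Fintype ι] in
/-- Conjugate-homogeneity of `⟪·, ·⟫_Γ` in the first argument. [folklore] -/
theorem gaussInner_smul_left (c : ℂ) (Q Q' : MvPolynomial ι ℂ) :
    gaussInner z σ P N₀ t (c • Q) Q' = conj c * gaussInner z σ P N₀ t Q Q' := by
  unfold gaussInner
  rw [← tsum_mul_left]
  refine tsum_congr fun m => ?_
  rw [sectorMul_smul, fockInner_smul_left]

omit [Fintype ι] in
/-- Homogeneity of `⟪·, ·⟫_Γ` in the second argument. [folklore] -/
theorem gaussInner_smul_right (c : ℂ) (Q Q' : MvPolynomial ι ℂ) :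
    gaussInner z σ P N₀ t Q (c • Q') = c * gaussInner z σ P N₀ t Q Q' := by
  unfold gaussInner
  rw [← tsum_mul_left]
  refine tsum_congr fun m => ?_
  rw [sectorMul_smul, fockInner_smul_right]

omit [Fintype ι] in
/-- `⟪0, Q'⟫_Γ = 0`. [folklore] -/
theorem gaussInner_zero_left (Q' : MvPolynomial ι ℂ) : gaussInner z σ P N₀ t 0 Q' = 0 := by
  simp [gaussInner, sectorMul_zero_left, fockInner_zero_left]

omit [Fintype ι] in
/-- `⟪Q, 0⟫_Γ = 0`. [folklore] -/
theorem gaussInner_zero_right (Q : MvPolynomial ι ℂ) : gaussInner z σ P N₀ t Q 0 = 0 := by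
  simp [gaussInner, sectorMul_zero_left, fockInner_zero_right]

omit [Fintype ι] in
/-- Hermitian symmetry. [folklore] -/
theorem conj_gaussInner (Q Q' : MvPolynomial ι ℂ) :
    conj (gaussInner z σ P N₀ t Q Q') = gaussInner z σ P N₀ t Q' Q := by
  unfold gaussInner
  rw [Complex.conj_tsum]
  exact tsum_congr fun m => conj_fockInner _ _

/-- Positivity: `re ⟪Q, Q⟫_Γ = ∑_m ‖(QΓ)_m‖² ≥ 0`. [folklore] -/
theorem gaussInner_self_re (hσ : Function.Involutive σ) (hσz : σ z = z)
    (hP : ∀ p ∈ P, σ p ∉ P) (hN₀ : 0 ≤ N₀) (ht : ∀ p ∈ P, |t p| < 1) (Q : MvPolynomial ι ℂ) :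
    (gaussInner z σ P N₀ t Q Q).re =
      ∑' m, (fockInner (sectorMul z σ P N₀ t Q m) (sectorMul z σ P N₀ t Q m)).re := by
  unfold gaussInner
  exact Complex.re_tsum (summable_fockInner_sectorMul hσ hσz hP hN₀ ht Q Q)

/-- Positivity `re ⟪Q, Q⟫_Γ ≥ 0`. [folklore] -/
theorem gaussInner_self_re_nonneg (hσ : Function.Involutive σ) (hσz : σ z = z)
    (hP : ∀ p ∈ P, σ p ∉ P) (hN₀ : 0 ≤ N₀) (ht : ∀ p ∈ P, |t p| < 1) (Q : MvPolynomial ι ℂ) :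
    0 ≤ (gaussInner z σ P N₀ t Q Q).re := by
  rw [gaussInner_self_re hσ hσz hP hN₀ ht]
  exact tsum_nonneg fun m => fockInner_self_re_nonneg _

omit [Fintype ι] [DecidableEq ι] in
/-- `‖1‖²_Fock = 1` (the vacuum). [folklore] -/
theorem fockInner_one_one : fockInner (1 : MvPolynomial ι ℂ) 1 = 1 := by
  classical
  rw [show (1 : MvPolynomial ι ℂ) = monomial 0 1 from rfl, fockInner_monomial, if_pos rfl]
  simp [occFactorial]

/-- **The Gaussian vector has norm at least `1`**: `re ⟪1, 1⟫_Γ = ∑_m ‖Γ_m‖² ≥ ‖Γ_0‖² = 1`.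
[folklore] -/
theorem one_le_gaussInner_one_one_re (hσ : Function.Involutive σ) (hσz : σ z = z)
    (hP : ∀ p ∈ P, σ p ∉ P) (hN₀ : 0 ≤ N₀) (ht : ∀ p ∈ P, |t p| < 1) :
    1 ≤ (gaussInner z σ P N₀ t 1 1).re := by
  rw [gaussInner_self_re hσ hσz hP hN₀ ht]
  have hs : Summable fun m => (fockInner (sectorMul z σ P N₀ t 1 m) (sectorMul z σ P N₀ t 1 m)).re :=
    (Complex.hasSum_re (hasSum_gaussInner hσ hσz hP hN₀ ht 1 1)).summable
  have h0 : (fockInner (sectorMul z σ P N₀ t 1 0) (sectorMul z σ P N₀ t 1 0)).re = 1 := by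
    rw [sectorMul_one, gaussSector_zero, fockInner_one_one, Complex.one_re]
  rw [← h0]
  exact hs.le_tsum 0 fun m _ => fockInner_self_re_nonneg _

/-- **LEMMA C (adjointness in the Gaussian picture)**:
`⟪X_q Q, Q'⟫_Γ = ⟪Q, ∂_q Q' + ℓ_q Q'⟫_Γ` — creation `a†_q = X_q·` on `QΓ` is adjoint to
`∂_q + ℓ_q·` on `Q'Γ` (the annihilation operator `a_q = ∂_q` conjugated through `Γ`), by the
finite-excitation adjointness `⟨a†p, q⟩ = ⟨p, aq⟩` sector by sector (`fockInner_cr_left`) and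
`∂_q(Q'Γ)_{m+1} = ((∂_q + ℓ_q)Q'Γ)_m`. [cite: LSSY2005, App. A (after (A.6)); BastiCenatiempoSchlein2021, (2.2), (2.11)] -/
theorem gaussInner_X_mul_left (hσ : Function.Involutive σ) (hσz : σ z = z)
    (hP : ∀ p ∈ P, σ p ∉ P) (hN₀ : 0 ≤ N₀) (ht : ∀ p ∈ P, |t p| < 1) (q : ι)
    (Q Q' : MvPolynomial ι ℂ) :
    gaussInner z σ P N₀ t (X q * Q) Q' =
      gaussInner z σ P N₀ t Q (pderiv q Q' + logDeriv z σ P N₀ t q * Q') := by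
  unfold gaussInner
  rw [(summable_fockInner_sectorMul hσ hσz hP hN₀ ht (X q * Q) Q').tsum_eq_zero_add,
    sectorMul_X_mul_zero, fockInner_zero_left, zero_add]
  refine tsum_congr fun m => ?_
  rw [sectorMul_X_mul_succ, ← cr_apply, fockInner_cr_left, an_apply, pderiv_sectorMul_succ hσ hP]

/-- LEMMA C, mirrored: `⟪Q, X_q Q'⟫_Γ = ⟪∂_q Q + ℓ_q Q, Q'⟫_Γ`. [folklore] -/
theorem gaussInner_X_mul_right (hσ : Function.Involutive σ) (hσz : σ z = z)
    (hP : ∀ p ∈ P, σ p ∉ P) (hN₀ : 0 ≤ N₀) (ht : ∀ p ∈ P, |t p| < 1) (q : ι)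
    (Q Q' : MvPolynomial ι ℂ) :
    gaussInner z σ P N₀ t Q (X q * Q') =
      gaussInner z σ P N₀ t (pderiv q Q + logDeriv z σ P N₀ t q * Q) Q' := by
  rw [← conj_gaussInner, gaussInner_X_mul_left hσ hσz hP hN₀ ht, conj_gaussInner]

end GaussInner

/-! ## F2. The Bogoliubov–Weyl transform in the Gaussian picture -/

/-! ### Bogoliubov amplitudes `γ_q = (1 - t̃_q²)^{-1/2}`, `σ_q = t̃_qγ_q` -/

/-- The **Bogoliubov amplitude** `γ_q = cosh ν_q = (1 - t̃_q²)^{-1/2}` (`t̃_q = tanh ν_q`).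
[cite: BastiCenatiempoSchlein2021, (2.11) (`γ_p = cosh(ν_p)`)] -/
def bogGamma [DecidableEq ι] (σ : ι → ι) (P : Finset ι) (t : ι → ℝ) (q : ι) : ℝ :=
  (Real.sqrt (1 - pairCoeff σ P t q ^ 2))⁻¹

/-- The **Bogoliubov amplitude** `σ_q = sinh ν_q = t̃_q γ_q`.
[cite: BastiCenatiempoSchlein2021, (2.11) (`σ_p = sinh(ν_p)`)] -/
def bogSigma [DecidableEq ι] (σ : ι → ι) (P : Finset ι) (t : ι → ℝ) (q : ι) : ℝ :=
  pairCoeff σ P t q * bogGamma σ P t q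

/-! ### Operators in the Gaussian picture `Q ↦ QΓ` -/

/-- The **annihilation operator in the Gaussian picture**: `a_q(QΓ) = (d_qQ)Γ` with
`d_q = ∂_q + ℓ_q·` (LEMMA B). [folklore] -/
def dOp [DecidableEq ι] (z : ι) (σ : ι → ι) (P : Finset ι) (N₀ : ℝ) (t : ι → ℝ) (q : ι) :
    Module.End ℂ (MvPolynomial ι ℂ) :=
  an q + LinearMap.mulLeft ℂ (logDeriv z σ P N₀ t q)

/-- The **Bogoliubov–Weyl annihilator** `b_q = γ_q d_q - σ_q X_{σq}· - √N₀[q = z]` in the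
Gaussian picture (`d_q = ∂_q + ℓ_q`), i.e. `W*T* a_q TW` transported along `Q ↦ QΓ`; it equals
`γ_q ∂_q` (`bAn_apply`) and kills the Gaussian-picture vacuum `1`.
[cite: BastiCenatiempoSchlein2021, (2.2), (2.11)] -/
def bAn [DecidableEq ι] (z : ι) (σ : ι → ι) (P : Finset ι) (N₀ : ℝ) (t : ι → ℝ) (q : ι) :
    Module.End ℂ (MvPolynomial ι ℂ) :=
  ((bogGamma σ P t q : ℝ) : ℂ) • dOp z σ P N₀ t q - ((bogSigma σ P t q : ℝ) : ℂ) • cr (σ q) -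
    (((if q = z then Real.sqrt N₀ else 0 : ℝ)) : ℂ) • LinearMap.id

/-- The **Bogoliubov–Weyl creator** `b†_q = γ_q X_q· - σ_q d_{σq} - √N₀[q = z]` in the Gaussian
picture, the `⟪·,·⟫_Γ`-adjoint of `b_q`; explicitly `b†_q = γ_q⁻¹X_q - σ_q∂_{σq} - √N₀[q = z]`
(`bCr_apply`). [cite: BastiCenatiempoSchlein2021, (2.2), (2.11)] -/
def bCr [DecidableEq ι] (z : ι) (σ : ι → ι) (P : Finset ι) (N₀ : ℝ) (t : ι → ℝ) (q : ι) :
    Module.End ℂ (MvPolynomial ι ℂ) :=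
  ((bogGamma σ P t q : ℝ) : ℂ) • cr q - ((bogSigma σ P t q : ℝ) : ℂ) • dOp z σ P N₀ t (σ q) -
    (((if q = z then Real.sqrt N₀ else 0 : ℝ)) : ℂ) • LinearMap.id

/-- The **conjugated annihilation operator** `T*W* a_q WT = γ_q a_q + σ_q a†_{σq} + √N₀[q = z]`
acting on finite-excitation vectors. [cite: BastiCenatiempoSchlein2021, (2.2), (2.11)] -/
def conjAn [DecidableEq ι] (z : ι) (σ : ι → ι) (P : Finset ι) (N₀ : ℝ) (t : ι → ℝ) (q : ι) :
    Module.End ℂ (MvPolynomial ι ℂ) :=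
  ((bogGamma σ P t q : ℝ) : ℂ) • an q + ((bogSigma σ P t q : ℝ) : ℂ) • cr (σ q) +
    (((if q = z then Real.sqrt N₀ else 0 : ℝ)) : ℂ) • LinearMap.id

/-- The **conjugated creation operator** `T*W* a†_q WT = γ_q a†_q + σ_q a_{σq} + √N₀[q = z]`
acting on finite-excitation vectors. [cite: BastiCenatiempoSchlein2021, (2.2), (2.11)] -/
def conjCr [DecidableEq ι] (z : ι) (σ : ι → ι) (P : Finset ι) (N₀ : ℝ) (t : ι → ℝ) (q : ι) :
    Module.End ℂ (MvPolynomial ι ℂ) :=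
  ((bogGamma σ P t q : ℝ) : ℂ) • cr q + ((bogSigma σ P t q : ℝ) : ℂ) • an (σ q) +
    (((if q = z then Real.sqrt N₀ else 0 : ℝ)) : ℂ) • LinearMap.id

section Amplitudes

variable [DecidableEq ι] {z : ι} {σ : ι → ι} {P : Finset ι} {N₀ : ℝ} {t : ι → ℝ}

/-- `1 - t̃_q² > 0`. [folklore] -/
theorem one_sub_pairCoeff_sq_pos (ht : ∀ p ∈ P, |t p| < 1) (q : ι) :
    0 < 1 - pairCoeff σ P t q ^ 2 := by
  have h := abs_pairCoeff_lt_one (σ := σ) (P := P) (t := t) ht q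
  have h0 := abs_nonneg (pairCoeff σ P t q)
  rw [← sq_abs]; nlinarith

/-- `γ_q > 0`. [folklore] -/
theorem bogGamma_pos (ht : ∀ p ∈ P, |t p| < 1) (q : ι) : 0 < bogGamma σ P t q := by
  unfold bogGamma
  exact inv_pos.2 (Real.sqrt_pos.2 (one_sub_pairCoeff_sq_pos ht q))

/-- `γ_q² (1 - t̃_q²) = 1`. [folklore] -/
theorem bogGamma_sq_mul (ht : ∀ p ∈ P, |t p| < 1) (q : ι) :
    bogGamma σ P t q ^ 2 * (1 - pairCoeff σ P t q ^ 2) = 1 := by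
  unfold bogGamma
  have h := one_sub_pairCoeff_sq_pos (σ := σ) (P := P) (t := t) ht q
  rw [inv_pow, Real.sq_sqrt h.le, inv_mul_cancel₀ h.ne']

/-- **`γ_q² - σ_q² = 1`.** [cite: BastiCenatiempoSchlein2021, (2.11)] -/
theorem bogGamma_sq_sub_bogSigma_sq (ht : ∀ p ∈ P, |t p| < 1) (q : ι) :
    bogGamma σ P t q ^ 2 - bogSigma σ P t q ^ 2 = 1 := by
  have h := bogGamma_sq_mul (σ := σ) (P := P) (t := t) ht q
  unfold bogSigma
  nlinarith [h]

/-- `γ_q⁻¹ = γ_q - σ_q t̃_q`. [folklore] -/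
theorem bogGamma_inv_eq (ht : ∀ p ∈ P, |t p| < 1) (q : ι) :
    (bogGamma σ P t q)⁻¹ = bogGamma σ P t q - bogSigma σ P t q * pairCoeff σ P t q := by
  have hg := bogGamma_pos (σ := σ) (P := P) (t := t) ht q
  have h := bogGamma_sq_mul (σ := σ) (P := P) (t := t) ht q
  unfold bogSigma
  symm
  apply eq_inv_of_mul_eq_one_left
  linear_combination h

/-- `σ_q γ_q⁻¹ = t̃_q` (`tanh = sinh/cosh`). [folklore] -/
theorem bogSigma_div_bogGamma (ht : ∀ p ∈ P, |t p| < 1) (q : ι) :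
    bogSigma σ P t q * (bogGamma σ P t q)⁻¹ = pairCoeff σ P t q := by
  have hg := bogGamma_pos (σ := σ) (P := P) (t := t) ht q
  unfold bogSigma
  field_simp

/-- Evenness `γ_{σq} = γ_q`. [folklore] -/
theorem bogGamma_partner (hσ : Function.Involutive σ) (hP : ∀ p ∈ P, σ p ∉ P) (q : ι) :
    bogGamma σ P t (σ q) = bogGamma σ P t q := by
  unfold bogGamma; rw [pairCoeff_partner hσ hP]

/-- Evenness `σ_{σq} = σ_q`. [folklore] -/
theorem bogSigma_partner (hσ : Function.Involutive σ) (hP : ∀ p ∈ P, σ p ∉ P) (q : ι) :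
    bogSigma σ P t (σ q) = bogSigma σ P t q := by
  unfold bogSigma; rw [pairCoeff_partner hσ hP, bogGamma_partner hσ hP]

/-- `γ_z = 1`. [folklore] -/
theorem bogGamma_z (hP : ∀ p ∈ P, σ p ∉ P) (hσz : σ z = z) : bogGamma σ P t z = 1 := by
  unfold bogGamma; rw [pairCoeff_z hP hσz]; simp

/-- `σ_z = 0`. [folklore] -/
theorem bogSigma_z (hP : ∀ p ∈ P, σ p ∉ P) (hσz : σ z = z) : bogSigma σ P t z = 0 := by
  unfold bogSigma; rw [pairCoeff_z hP hσz]; simp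

end Amplitudes

/-! ### The operators `d_q`, `b_q`, `b†_q` explicitly, and the conjugation formulas -/

section Operators

variable [DecidableEq ι] {z : ι} {σ : ι → ι} {P : Finset ι} {N₀ : ℝ} {t : ι → ℝ}

/-- `d_q Q = ∂_q Q + ℓ_q Q`. [folklore] -/
theorem dOp_apply (q : ι) (Q : MvPolynomial ι ℂ) :
    dOp z σ P N₀ t q Q = pderiv q Q + logDeriv z σ P N₀ t q * Q := rfl

/-- The condensate shift vanishes against `γ_q - 1` (`γ_z = 1`). [folklore] -/
theorem shift_mul_bogGamma_sub_one (hP : ∀ p ∈ P, σ p ∉ P) (hσz : σ z = z) (q : ι) :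
    (if q = z then Real.sqrt N₀ else 0) * (bogGamma σ P t q - 1) = 0 := by
  by_cases h : q = z
  · rw [if_pos h, h, bogGamma_z hP hσz, sub_self, mul_zero]
  · rw [if_neg h, zero_mul]

/-- The condensate shift at the partner vanishes against `σ_q` (`σ_z = 0`). [folklore] -/
theorem bogSigma_mul_shift_partner (hσ : Function.Involutive σ) (hP : ∀ p ∈ P, σ p ∉ P)
    (hσz : σ z = z) (q : ι) :
    bogSigma σ P t q * (if σ q = z then Real.sqrt N₀ else 0) = 0 := by
  by_cases h : σ q = z
  · have hq : q = z := by rw [← hσ q, h, hσz]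
    rw [if_pos h, hq, bogSigma_z hP hσz, zero_mul]
  · rw [if_neg h, mul_zero]

/-- **`b_q = γ_q ∂_q`** in the Gaussian picture. [cite: BastiCenatiempoSchlein2021, (2.11)] -/
theorem bAn_apply (hP : ∀ p ∈ P, σ p ∉ P) (hσz : σ z = z) (q : ι) (Q : MvPolynomial ι ℂ) :
    bAn z σ P N₀ t q Q = C ((bogGamma σ P t q : ℝ) : ℂ) * pderiv q Q := by
  have h1 := shift_mul_bogGamma_sub_one (N₀ := N₀) (t := t) hP hσz q
  simp only [bAn, LinearMap.sub_apply, LinearMap.smul_apply, LinearMap.id_apply, dOp_apply,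
    cr_apply, logDeriv, bogSigma, smul_eq_C_mul]
  have h1' : (C (((if q = z then Real.sqrt N₀ else 0) * (bogGamma σ P t q - 1) : ℝ) : ℂ) :
      MvPolynomial ι ℂ) = 0 := by rw [h1]; simp
  push_cast at h1' ⊢
  rw [map_mul, map_sub, map_one] at h1'
  rw [map_mul]
  linear_combination Q * h1'

/-- **`b†_q Q = γ_q⁻¹ X_q Q - σ_q ∂_{σq} Q - √N₀[q = z] Q`** in the Gaussian picture.
[cite: BastiCenatiempoSchlein2021, (2.11)] -/
theorem bCr_apply (hσ : Function.Involutive σ) (hP : ∀ p ∈ P, σ p ∉ P) (hσz : σ z = z)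
    (ht : ∀ p ∈ P, |t p| < 1) (q : ι) (Q : MvPolynomial ι ℂ) :
    bCr z σ P N₀ t q Q = C ((((bogGamma σ P t q)⁻¹ : ℝ) : ℂ)) * (X q * Q) -
      C ((bogSigma σ P t q : ℝ) : ℂ) * pderiv (σ q) Q -
      C ((((if q = z then Real.sqrt N₀ else 0 : ℝ)) : ℂ)) * Q := by
  have h1 := bogSigma_mul_shift_partner (N₀ := N₀) (t := t) hσ hP hσz q
  have h2 := bogGamma_inv_eq (σ := σ) (P := P) (t := t) ht q
  simp only [bCr, LinearMap.sub_apply, LinearMap.smul_apply, LinearMap.id_apply, dOp_apply,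
    cr_apply, logDeriv, pairCoeff_partner hσ hP, hσ q, smul_eq_C_mul]
  have h1' : (C ((bogSigma σ P t q * (if σ q = z then Real.sqrt N₀ else 0) : ℝ) : ℂ) :
      MvPolynomial ι ℂ) = 0 := by rw [h1]; simp
  have h2' : (C (((bogGamma σ P t q)⁻¹ : ℝ) : ℂ) : MvPolynomial ι ℂ) =
      C ((bogGamma σ P t q - bogSigma σ P t q * pairCoeff σ P t q : ℝ) : ℂ) := by rw [h2]
  push_cast at h1' h2' ⊢
  rw [map_mul] at h1'
  rw [map_sub, map_mul] at h2'
  linear_combination (-1 : MvPolynomial ι ℂ) * Q * h1' - X q * Q * h2'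

/-- **The conjugation formula for annihilation**:
`d_q = γ_q b_q + σ_q b†_{σq} + √N₀[q = z]` — in the Gaussian picture this is
`W*T* a_q TW`-in-reverse, i.e. `T*W* a_q WT = γ_q a_q + σ_q a†_{-q} + √N₀ δ_{q,0}`.
[cite: BastiCenatiempoSchlein2021, (2.2), (2.11)] -/
theorem dOp_eq_bAn_bCr (hσ : Function.Involutive σ) (hP : ∀ p ∈ P, σ p ∉ P) (hσz : σ z = z)
    (ht : ∀ p ∈ P, |t p| < 1) (q : ι) (Q : MvPolynomial ι ℂ) :
    dOp z σ P N₀ t q Q = C ((bogGamma σ P t q : ℝ) : ℂ) * bAn z σ P N₀ t q Q +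
      C ((bogSigma σ P t q : ℝ) : ℂ) * bCr z σ P N₀ t (σ q) Q +
      C ((((if q = z then Real.sqrt N₀ else 0 : ℝ)) : ℂ)) * Q := by
  have h1 := shift_mul_bogGamma_sub_one (N₀ := N₀) (t := t) hP hσz q
  have h2 := bogSigma_mul_shift_partner (N₀ := N₀) (t := t) hσ hP hσz q
  have h3 := bogGamma_sq_sub_bogSigma_sq (σ := σ) (P := P) (t := t) ht q
  simp only [bAn, bCr, LinearMap.sub_apply, LinearMap.smul_apply, LinearMap.id_apply,
    cr_apply, bogGamma_partner hσ hP, bogSigma_partner hσ hP, hσ q, smul_eq_C_mul]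
  have h1' : (C (((if q = z then Real.sqrt N₀ else 0) * (bogGamma σ P t q - 1) : ℝ) : ℂ) :
      MvPolynomial ι ℂ) = 0 := by rw [h1]; simp
  have h2' : (C ((bogSigma σ P t q * (if σ q = z then Real.sqrt N₀ else 0) : ℝ) : ℂ) :
      MvPolynomial ι ℂ) = 0 := by rw [h2]; simp
  have h3' : (C ((bogGamma σ P t q ^ 2 - bogSigma σ P t q ^ 2 : ℝ) : ℂ) : MvPolynomial ι ℂ) = 1 := by
    rw [h3]; simp
  push_cast at h1' h2' h3' ⊢
  rw [map_mul, map_sub, map_one] at h1'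
  rw [map_mul] at h2'
  rw [map_sub, map_pow, map_pow] at h3'
  linear_combination (-1 : MvPolynomial ι ℂ) * (dOp z σ P N₀ t q Q) * h3' + Q * h1' + Q * h2'

/-- **The conjugation formula for creation**:
`X_q· = γ_q b†_q + σ_q b_{σq} + √N₀[q = z]`, i.e. `T*W* a†_q WT = γ_q a†_q + σ_q a_{-q} + √N₀ δ_{q,0}`.
[cite: BastiCenatiempoSchlein2021, (2.2), (2.11)] -/
theorem cr_eq_bCr_bAn (hσ : Function.Involutive σ) (hP : ∀ p ∈ P, σ p ∉ P) (hσz : σ z = z)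
    (ht : ∀ p ∈ P, |t p| < 1) (q : ι) (Q : MvPolynomial ι ℂ) :
    X q * Q = C ((bogGamma σ P t q : ℝ) : ℂ) * bCr z σ P N₀ t q Q +
      C ((bogSigma σ P t q : ℝ) : ℂ) * bAn z σ P N₀ t (σ q) Q +
      C ((((if q = z then Real.sqrt N₀ else 0 : ℝ)) : ℂ)) * Q := by
  have h1 := shift_mul_bogGamma_sub_one (N₀ := N₀) (t := t) hP hσz q
  have h2 := bogSigma_mul_shift_partner (N₀ := N₀) (t := t) hσ hP hσz q
  have h3 := bogGamma_sq_sub_bogSigma_sq (σ := σ) (P := P) (t := t) ht q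
  simp only [bAn, bCr, LinearMap.sub_apply, LinearMap.smul_apply, LinearMap.id_apply,
    cr_apply, bogGamma_partner hσ hP, bogSigma_partner hσ hP, hσ q, smul_eq_C_mul]
  have h1' : (C (((if q = z then Real.sqrt N₀ else 0) * (bogGamma σ P t q - 1) : ℝ) : ℂ) :
      MvPolynomial ι ℂ) = 0 := by rw [h1]; simp
  have h2' : (C ((bogSigma σ P t q * (if σ q = z then Real.sqrt N₀ else 0) : ℝ) : ℂ) :
      MvPolynomial ι ℂ) = 0 := by rw [h2]; simp
  have h3' : (C ((bogGamma σ P t q ^ 2 - bogSigma σ P t q ^ 2 : ℝ) : ℂ) : MvPolynomial ι ℂ) = 1 := by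
    rw [h3]; simp
  push_cast at h1' h2' h3' ⊢
  rw [map_mul, map_sub, map_one] at h1'
  rw [map_mul] at h2'
  rw [map_sub, map_pow, map_pow] at h3'
  linear_combination (-1 : MvPolynomial ι ℂ) * (X q * Q) * h3' + Q * h1' + Q * h2'

/-- **`b_q` kills the Gaussian-picture vacuum**: `b_q 1 = 0`. [cite: BastiCenatiempoSchlein2021, (2.11)] -/
theorem bAn_one (hP : ∀ p ∈ P, σ p ∉ P) (hσz : σ z = z) (q : ι) :
    bAn z σ P N₀ t q 1 = 0 := by
  rw [bAn_apply hP hσz, pderiv_one, mul_zero]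

/-- **CCR `[b_p, b†_q] = δ_{pq}`.** [cite: BastiCenatiempoSchlein2021, (2.6) with (2.11)] -/
theorem bAn_bCr (hσ : Function.Involutive σ) (hP : ∀ p ∈ P, σ p ∉ P) (hσz : σ z = z)
    (ht : ∀ p ∈ P, |t p| < 1) (p q : ι) (Q : MvPolynomial ι ℂ) :
    bAn z σ P N₀ t p (bCr z σ P N₀ t q Q) =
      bCr z σ P N₀ t q (bAn z σ P N₀ t p Q) + if p = q then Q else 0 := by
  have hg : bogGamma σ P t p ≠ 0 := (bogGamma_pos ht p).ne'
  have hcomm : pderiv (σ q) (pderiv p Q) = pderiv p (pderiv (σ q) Q) := an_an_comm (σ q) p Q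
  simp only [bAn_apply hP hσz, bCr_apply hσ hP hσz ht, map_sub, pderiv_mul, pderiv_C, pderiv_X,
    Pi.single_apply, hcomm, mul_add, mul_sub, zero_mul, zero_add]
  by_cases hpq : p = q
  · subst hpq
    simp only [if_true]
    have hγ : (C ((bogGamma σ P t p : ℝ) : ℂ) * C (((bogGamma σ P t p)⁻¹ : ℝ) : ℂ) :
        MvPolynomial ι ℂ) = 1 := by
      rw [← map_mul, ← Complex.ofReal_mul, mul_inv_cancel₀ hg]; simp
    linear_combination Q * hγ
  · rw [if_neg (Ne.symm hpq), if_neg hpq]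
    ring

/-- **CCR `[b†_p, b†_q] = 0`** (uses the evenness `γ_{σq} = γ_q`, `σ_{σq} = σ_q`).
[cite: BastiCenatiempoSchlein2021, (2.6) with (2.11)] -/
theorem bCr_bCr_comm (hσ : Function.Involutive σ) (hP : ∀ p ∈ P, σ p ∉ P) (hσz : σ z = z)
    (ht : ∀ p ∈ P, |t p| < 1) (p q : ι) (Q : MvPolynomial ι ℂ) :
    bCr z σ P N₀ t p (bCr z σ P N₀ t q Q) = bCr z σ P N₀ t q (bCr z σ P N₀ t p Q) := by
  have hcomm : pderiv (σ q) (pderiv (σ p) Q) = pderiv (σ p) (pderiv (σ q) Q) :=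
    an_an_comm (σ q) (σ p) Q
  simp only [bCr_apply hσ hP hσz ht, map_sub, pderiv_mul, pderiv_C, pderiv_X, Pi.single_apply,
    hcomm, mul_add, mul_sub, zero_mul, zero_add]
  by_cases h : q = σ p
  · subst h
    simp only [hσ p, if_true, bogGamma_partner hσ hP, bogSigma_partner hσ hP]
    ring
  · have h' : ¬ p = σ q := fun h'' => h (by rw [h'', hσ q])
    rw [if_neg h, if_neg h']
    ring

/-- **CCR `[b_p, b_q] = 0`.** [cite: BastiCenatiempoSchlein2021, (2.6) with (2.11)] -/
theorem bAn_bAn_comm (hP : ∀ p ∈ P, σ p ∉ P) (hσz : σ z = z) (p q : ι) (Q : MvPolynomial ι ℂ) :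
    bAn z σ P N₀ t p (bAn z σ P N₀ t q Q) = bAn z σ P N₀ t q (bAn z σ P N₀ t p Q) := by
  have hcomm : pderiv p (pderiv q Q) = pderiv q (pderiv p Q) := an_an_comm p q Q
  simp only [bAn_apply hP hσz, pderiv_C_mul, hcomm]
  ring

end Operators

/-! ### Adjointness of `b_q` and `b†_q` for `⟪·,·⟫_Γ` -/

section Adjoint

variable [Fintype ι] [DecidableEq ι] {z : ι} {σ : ι → ι} {P : Finset ι} {N₀ : ℝ} {t : ι → ℝ}

omit [Fintype ι] in
/-- `⟪-Q, Q'⟫_Γ = -⟪Q, Q'⟫_Γ`. [folklore] -/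
theorem gaussInner_neg_left (Q Q' : MvPolynomial ι ℂ) :
    gaussInner z σ P N₀ t (-Q) Q' = -gaussInner z σ P N₀ t Q Q' := by
  rw [show -Q = (-1 : ℂ) • Q by simp, gaussInner_smul_left]; simp

omit [Fintype ι] in
/-- `⟪Q, -Q'⟫_Γ = -⟪Q, Q'⟫_Γ`. [folklore] -/
theorem gaussInner_neg_right (Q Q' : MvPolynomial ι ℂ) :
    gaussInner z σ P N₀ t Q (-Q') = -gaussInner z σ P N₀ t Q Q' := by
  rw [show -Q' = (-1 : ℂ) • Q' by simp, gaussInner_smul_right]; simp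

/-- Subtraction in the first argument. [folklore] -/
theorem gaussInner_sub_left (hσ : Function.Involutive σ) (hσz : σ z = z)
    (hP : ∀ p ∈ P, σ p ∉ P) (hN₀ : 0 ≤ N₀) (ht : ∀ p ∈ P, |t p| < 1)
    (Q₁ Q₂ Q' : MvPolynomial ι ℂ) :
    gaussInner z σ P N₀ t (Q₁ - Q₂) Q' = gaussInner z σ P N₀ t Q₁ Q' - gaussInner z σ P N₀ t Q₂ Q' := by
  rw [sub_eq_add_neg, gaussInner_add_left hσ hσz hP hN₀ ht, gaussInner_neg_left, ← sub_eq_add_neg]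

/-- Subtraction in the second argument. [folklore] -/
theorem gaussInner_sub_right (hσ : Function.Involutive σ) (hσz : σ z = z)
    (hP : ∀ p ∈ P, σ p ∉ P) (hN₀ : 0 ≤ N₀) (ht : ∀ p ∈ P, |t p| < 1)
    (Q Q₁ Q₂ : MvPolynomial ι ℂ) :
    gaussInner z σ P N₀ t Q (Q₁ - Q₂) = gaussInner z σ P N₀ t Q Q₁ - gaussInner z σ P N₀ t Q Q₂ := by
  rw [sub_eq_add_neg, gaussInner_add_right hσ hσz hP hN₀ ht, gaussInner_neg_right, ← sub_eq_add_neg]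

omit [Fintype ι] in
/-- Real scalars pass through the first argument unconjugated. [folklore] -/
theorem gaussInner_real_smul_left (r : ℝ) (Q Q' : MvPolynomial ι ℂ) :
    gaussInner z σ P N₀ t (((r : ℂ)) • Q) Q' = (r : ℂ) * gaussInner z σ P N₀ t Q Q' := by
  rw [gaussInner_smul_left, Complex.conj_ofReal]

/-- **LEMMA C in operator form**: `⟪d_q Q, Q'⟫_Γ = ⟪Q, X_q Q'⟫_Γ`. [folklore] -/
theorem gaussInner_dOp_left (hσ : Function.Involutive σ) (hσz : σ z = z)
    (hP : ∀ p ∈ P, σ p ∉ P) (hN₀ : 0 ≤ N₀) (ht : ∀ p ∈ P, |t p| < 1) (q : ι)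
    (Q Q' : MvPolynomial ι ℂ) :
    gaussInner z σ P N₀ t (dOp z σ P N₀ t q Q) Q' = gaussInner z σ P N₀ t Q (X q * Q') := by
  rw [dOp_apply, gaussInner_X_mul_right hσ hσz hP hN₀ ht]

/-- **LEMMA C in operator form**: `⟪X_q Q, Q'⟫_Γ = ⟪Q, d_q Q'⟫_Γ`. [folklore] -/
theorem gaussInner_cr_left (hσ : Function.Involutive σ) (hσz : σ z = z)
    (hP : ∀ p ∈ P, σ p ∉ P) (hN₀ : 0 ≤ N₀) (ht : ∀ p ∈ P, |t p| < 1) (q : ι)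
    (Q Q' : MvPolynomial ι ℂ) :
    gaussInner z σ P N₀ t (X q * Q) Q' = gaussInner z σ P N₀ t Q (dOp z σ P N₀ t q Q') := by
  rw [dOp_apply, gaussInner_X_mul_left hσ hσz hP hN₀ ht]

/-- **`b†_q` is the adjoint of `b_q`**: `⟪b†_q Q, Q'⟫_Γ = ⟪Q, b_q Q'⟫_Γ`.
[cite: BastiCenatiempoSchlein2021, (2.11) (`T_ν` unitary)] -/
theorem gaussInner_bCr_left (hσ : Function.Involutive σ) (hσz : σ z = z)
    (hP : ∀ p ∈ P, σ p ∉ P) (hN₀ : 0 ≤ N₀) (ht : ∀ p ∈ P, |t p| < 1) (q : ι)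
    (Q Q' : MvPolynomial ι ℂ) :
    gaussInner z σ P N₀ t (bCr z σ P N₀ t q Q) Q' = gaussInner z σ P N₀ t Q (bAn z σ P N₀ t q Q') := by
  simp only [bCr, bAn, LinearMap.sub_apply, LinearMap.smul_apply, LinearMap.id_apply, cr_apply]
  rw [gaussInner_sub_left hσ hσz hP hN₀ ht, gaussInner_sub_left hσ hσz hP hN₀ ht,
    gaussInner_sub_right hσ hσz hP hN₀ ht, gaussInner_sub_right hσ hσz hP hN₀ ht,
    gaussInner_real_smul_left, gaussInner_real_smul_left, gaussInner_real_smul_left,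
    gaussInner_smul_right, gaussInner_smul_right, gaussInner_smul_right,
    gaussInner_cr_left hσ hσz hP hN₀ ht, gaussInner_dOp_left hσ hσz hP hN₀ ht]

/-- **`b_q` is the adjoint of `b†_q`**: `⟪b_q Q, Q'⟫_Γ = ⟪Q, b†_q Q'⟫_Γ`.
[cite: BastiCenatiempoSchlein2021, (2.11) (`T_ν` unitary)] -/
theorem gaussInner_bAn_left (hσ : Function.Involutive σ) (hσz : σ z = z)
    (hP : ∀ p ∈ P, σ p ∉ P) (hN₀ : 0 ≤ N₀) (ht : ∀ p ∈ P, |t p| < 1) (q : ι)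
    (Q Q' : MvPolynomial ι ℂ) :
    gaussInner z σ P N₀ t (bAn z σ P N₀ t q Q) Q' = gaussInner z σ P N₀ t Q (bCr z σ P N₀ t q Q') := by
  rw [← conj_gaussInner, ← gaussInner_bCr_left hσ hσz hP hN₀ ht, conj_gaussInner]

end Adjoint

/-! ### The Bogoliubov–Weyl map `𝒯ξ = ξ(b†)1` -/

section Transform

open scoped IsMulCommutative

variable [DecidableEq ι] {z : ι} {σ : ι → ι} {P : Finset ι} {N₀ : ℝ} {t : ι → ℝ}

/-- The creators `b†_q` commute pairwise (as elements of `End`). [cite: BastiCenatiempoSchlein2021, (2.6) with (2.11)] -/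
theorem bCr_range_comm (hσ : Function.Involutive σ) (hP : ∀ p ∈ P, σ p ∉ P) (hσz : σ z = z)
    (ht : ∀ p ∈ P, |t p| < 1) :
    ∀ a ∈ Set.range (bCr z σ P N₀ t), ∀ b ∈ Set.range (bCr z σ P N₀ t), a * b = b * a := by
  rintro a ⟨p, rfl⟩ b ⟨q, rfl⟩
  refine LinearMap.ext fun Q => ?_
  rw [Module.End.mul_apply, Module.End.mul_apply]
  exact bCr_bCr_comm hσ hP hσz ht p q Q

/-- The algebra homomorphism `ξ ↦ ξ(b†)` into the commutative subalgebra of `End` generated by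
the pairwise commuting creators `b†_q`. [folklore] -/
def bogTHom (z : ι) (σ : ι → ι) (P : Finset ι) (N₀ : ℝ) (t : ι → ℝ)
    (h : ∀ a ∈ Set.range (bCr z σ P N₀ t), ∀ b ∈ Set.range (bCr z σ P N₀ t), a * b = b * a) :
    MvPolynomial ι ℂ →ₐ[ℂ] Algebra.adjoin ℂ (Set.range (bCr z σ P N₀ t)) :=
  haveI := Algebra.isMulCommutative_adjoin ℂ h
  MvPolynomial.aeval fun q => (⟨bCr z σ P N₀ t q, Algebra.subset_adjoin ⟨q, rfl⟩⟩ :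
    Algebra.adjoin ℂ (Set.range (bCr z σ P N₀ t)))

open Classical in
/-- The **Bogoliubov–Weyl map** `𝒯ξ = ξ(b†) 1`: the finite-excitation vector `ξ = ξ(a†)Ω` is sent
to the Gaussian-picture polynomial `ξ(b†)1`, so that `(𝒯ξ)Γ = W(N₀)T_ν ξ` (up to the norm of
`Γ`): `𝒯(X_qξ) = b†_q 𝒯ξ`, `𝒯(∂_qξ) = b_q 𝒯ξ`, `𝒯1 = 1`. (Defined as `0` for inadmissible data,
for which the `b†_q` need not commute.) [cite: BastiCenatiempoSchlein2021, (2.12) (`Ψ_N = W_{N₀}T_ν ξ_ν/‖…‖`)] -/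
def bogT (z : ι) (σ : ι → ι) (P : Finset ι) (N₀ : ℝ) (t : ι → ℝ) (ξ : MvPolynomial ι ℂ) :
    MvPolynomial ι ℂ :=
  if h : ∀ a ∈ Set.range (bCr z σ P N₀ t), ∀ b ∈ Set.range (bCr z σ P N₀ t), a * b = b * a then
    ((bogTHom z σ P N₀ t h ξ : Algebra.adjoin ℂ (Set.range (bCr z σ P N₀ t))) :
      Module.End ℂ (MvPolynomial ι ℂ)) 1
  else 0

/-- Unfolding `𝒯` for admissible data. [folklore] -/
theorem bogT_eq (h : ∀ a ∈ Set.range (bCr z σ P N₀ t), ∀ b ∈ Set.range (bCr z σ P N₀ t),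
    a * b = b * a) (ξ : MvPolynomial ι ℂ) :
    bogT z σ P N₀ t ξ = ((bogTHom z σ P N₀ t h ξ : Algebra.adjoin ℂ (Set.range (bCr z σ P N₀ t))) :
      Module.End ℂ (MvPolynomial ι ℂ)) 1 := by
  rw [bogT, dif_pos h]

/-- **`𝒯(X_q ξ) = b†_q 𝒯ξ`.** [cite: BastiCenatiempoSchlein2021, (2.11)–(2.12)] -/
theorem bogT_X_mul (h : ∀ a ∈ Set.range (bCr z σ P N₀ t), ∀ b ∈ Set.range (bCr z σ P N₀ t),
    a * b = b * a) (q : ι) (ξ : MvPolynomial ι ℂ) :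
    bogT z σ P N₀ t (X q * ξ) = bCr z σ P N₀ t q (bogT z σ P N₀ t ξ) := by
  haveI := Algebra.isMulCommutative_adjoin ℂ h
  rw [bogT_eq h, bogT_eq h, bogTHom, map_mul, aeval_X]
  rfl

/-- `𝒯(ξ X_q) = b†_q 𝒯ξ`. [folklore] -/
theorem bogT_mul_X (h : ∀ a ∈ Set.range (bCr z σ P N₀ t), ∀ b ∈ Set.range (bCr z σ P N₀ t),
    a * b = b * a) (q : ι) (ξ : MvPolynomial ι ℂ) :
    bogT z σ P N₀ t (ξ * X q) = bCr z σ P N₀ t q (bogT z σ P N₀ t ξ) := by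
  rw [mul_comm, bogT_X_mul h]

/-- **`𝒯(C a) = C a`** (in particular `𝒯1 = 1`: the vacuum goes to the Gaussian-picture vacuum).
[folklore] -/
theorem bogT_C (h : ∀ a ∈ Set.range (bCr z σ P N₀ t), ∀ b ∈ Set.range (bCr z σ P N₀ t),
    a * b = b * a) (a : ℂ) : bogT z σ P N₀ t (C a) = C a := by
  haveI := Algebra.isMulCommutative_adjoin ℂ h
  rw [bogT_eq h, bogTHom, aeval_C, Subalgebra.coe_algebraMap, Module.algebraMap_end_apply,
    smul_eq_C_mul, mul_one]

/-- `𝒯 1 = 1`. [folklore] -/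
theorem bogT_one (h : ∀ a ∈ Set.range (bCr z σ P N₀ t), ∀ b ∈ Set.range (bCr z σ P N₀ t),
    a * b = b * a) : bogT z σ P N₀ t 1 = 1 := by
  rw [← C_1, bogT_C h]

/-- `𝒯` is additive. [folklore] -/
theorem bogT_add (h : ∀ a ∈ Set.range (bCr z σ P N₀ t), ∀ b ∈ Set.range (bCr z σ P N₀ t),
    a * b = b * a) (ξ ξ' : MvPolynomial ι ℂ) :
    bogT z σ P N₀ t (ξ + ξ') = bogT z σ P N₀ t ξ + bogT z σ P N₀ t ξ' := by
  rw [bogT_eq h, bogT_eq h, bogT_eq h, map_add, Subalgebra.coe_add, LinearMap.add_apply]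

/-- `𝒯` is `ℂ`-linear. [folklore] -/
theorem bogT_smul (h : ∀ a ∈ Set.range (bCr z σ P N₀ t), ∀ b ∈ Set.range (bCr z σ P N₀ t),
    a * b = b * a) (c : ℂ) (ξ : MvPolynomial ι ℂ) :
    bogT z σ P N₀ t (c • ξ) = c • bogT z σ P N₀ t ξ := by
  rw [bogT_eq h, bogT_eq h, map_smul, Subalgebra.coe_smul, LinearMap.smul_apply]

/-- `𝒯(C c · ξ) = C c · 𝒯ξ`. [folklore] -/
theorem bogT_C_mul (h : ∀ a ∈ Set.range (bCr z σ P N₀ t), ∀ b ∈ Set.range (bCr z σ P N₀ t),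
    a * b = b * a) (c : ℂ) (ξ : MvPolynomial ι ℂ) :
    bogT z σ P N₀ t (C c * ξ) = C c * bogT z σ P N₀ t ξ := by
  rw [← smul_eq_C_mul, bogT_smul h, smul_eq_C_mul]

/-- `𝒯 0 = 0`. [folklore] -/
theorem bogT_zero (h : ∀ a ∈ Set.range (bCr z σ P N₀ t), ∀ b ∈ Set.range (bCr z σ P N₀ t),
    a * b = b * a) : bogT z σ P N₀ t 0 = 0 := by
  rw [← C_0, bogT_C h]

/-- **`𝒯(∂_q ξ) = b_q 𝒯ξ`** (from the CCR `[b_q, b†_n] = δ` and `b_q 1 = 0`).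
[cite: BastiCenatiempoSchlein2021, (2.11)–(2.12)] -/
theorem bogT_pderiv (hσ : Function.Involutive σ) (hP : ∀ p ∈ P, σ p ∉ P) (hσz : σ z = z)
    (ht : ∀ p ∈ P, |t p| < 1) (q : ι) (ξ : MvPolynomial ι ℂ) :
    bogT z σ P N₀ t (pderiv q ξ) = bAn z σ P N₀ t q (bogT z σ P N₀ t ξ) := by
  have h := bCr_range_comm (N₀ := N₀) hσ hP hσz ht
  induction ξ using MvPolynomial.induction_on with
  | C a =>
    rw [pderiv_C, bogT_zero h, bogT_C h, bAn_apply hP hσz, pderiv_C, mul_zero]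
  | add p₁ p₂ h₁ h₂ =>
    rw [map_add, bogT_add h, h₁, h₂, bogT_add h, map_add]
  | mul_X p₁ n ih =>
    rw [pderiv_mul, pderiv_X, bogT_add h, bogT_mul_X h, ih, bogT_mul_X h,
      bAn_bCr hσ hP hσz ht q n]
    congr 1
    simp only [Pi.single_apply]
    by_cases hnq : n = q
    · subst hnq; simp
    · rw [if_neg hnq, if_neg (Ne.symm hnq), mul_zero, bogT_zero h]

end Transform

/-! ### The Wick isometry and the master intertwining identities -/

section Wick

variable [Fintype ι] [DecidableEq ι] {z : ι} {σ : ι → ι} {P : Finset ι} {N₀ : ℝ} {t : ι → ℝ}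

omit [Fintype ι] [DecidableEq ι] in
/-- `⟨q', X_i p'⟩ = ⟨∂_i q', p'⟩` (creation on the right). [cite: LSSY2005, App. A (after (A.6))] -/
theorem fockInner_X_mul_right (i : ι) (p' q' : MvPolynomial ι ℂ) :
    fockInner q' (X i * p') = fockInner (pderiv i q') p' := by
  rw [← conj_fockInner, ← cr_apply, fockInner_cr_left, an_apply, conj_fockInner]

/-- **`⟪1, 𝒯ξ'⟫_Γ = ⟪1,1⟫_Γ ⟨1, ξ'⟩`** (the vacuum row of the Wick isometry). [folklore] -/
theorem gaussInner_one_bogT (hσ : Function.Involutive σ) (hσz : σ z = z)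
    (hP : ∀ p ∈ P, σ p ∉ P) (hN₀ : 0 ≤ N₀) (ht : ∀ p ∈ P, |t p| < 1) (ξ' : MvPolynomial ι ℂ) :
    gaussInner z σ P N₀ t 1 (bogT z σ P N₀ t ξ') = gaussInner z σ P N₀ t 1 1 * fockInner 1 ξ' := by
  have h := bCr_range_comm (N₀ := N₀) hσ hP hσz ht
  induction ξ' using MvPolynomial.induction_on with
  | C a =>
    rw [bogT_C h, show (C a : MvPolynomial ι ℂ) = a • 1 by rw [smul_eq_C_mul, mul_one],
      gaussInner_smul_right, fockInner_smul_right, fockInner_one_one]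
    ring
  | add p₁ p₂ h₁ h₂ =>
    rw [bogT_add h, gaussInner_add_right hσ hσz hP hN₀ ht, h₁, h₂, fockInner_add_right, mul_add]
  | mul_X p₁ n _ =>
    rw [bogT_mul_X h, ← gaussInner_bAn_left hσ hσz hP hN₀ ht, bAn_one hP hσz, gaussInner_zero_left,
      mul_comm p₁, fockInner_X_mul_right, pderiv_one, fockInner_zero_left, mul_zero]

/-- **THE WICK ISOMETRY `⟪𝒯ξ, 𝒯ξ'⟫_Γ = ⟪1,1⟫_Γ · ⟨ξ, ξ'⟩`**: up to the common factor
`‖Γ‖² = ⟪1,1⟫_Γ`, the Bogoliubov–Weyl map is an isometry from the finite-excitation Fock space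
onto the Gaussian-picture polynomials — the algebraic content of the unitarity of `W(N₀)T_ν`
[BastiCenatiempoSchlein2021, (2.2), (2.11)]. In particular `‖(𝒯ξ)Γ‖² = ‖Γ‖²‖ξ‖²`, so the
normalised trial vector `W(N₀)T_νξ/‖ξ‖` has all its expectations given by `⟨ξ, · ξ⟩/‖ξ‖²`.
[cite: BastiCenatiempoSchlein2021, (2.12) and (3.1)] -/
theorem gaussInner_bogT_bogT (hσ : Function.Involutive σ) (hσz : σ z = z)
    (hP : ∀ p ∈ P, σ p ∉ P) (hN₀ : 0 ≤ N₀) (ht : ∀ p ∈ P, |t p| < 1) (ξ ξ' : MvPolynomial ι ℂ) :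
    gaussInner z σ P N₀ t (bogT z σ P N₀ t ξ) (bogT z σ P N₀ t ξ') =
      gaussInner z σ P N₀ t 1 1 * fockInner ξ ξ' := by
  have h := bCr_range_comm (N₀ := N₀) hσ hP hσz ht
  induction ξ using MvPolynomial.induction_on generalizing ξ' with
  | C a =>
    rw [bogT_C h, show (C a : MvPolynomial ι ℂ) = a • 1 by rw [smul_eq_C_mul, mul_one],
      gaussInner_smul_left, fockInner_smul_left, gaussInner_one_bogT hσ hσz hP hN₀ ht]
    ring
  | add p₁ p₂ h₁ h₂ =>
    rw [bogT_add h, gaussInner_add_left hσ hσz hP hN₀ ht, h₁, h₂, fockInner_add_left, mul_add]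
  | mul_X p₁ n ih =>
    rw [bogT_mul_X h, gaussInner_bCr_left hσ hσz hP hN₀ ht, ← bogT_pderiv hσ hP hσz ht, ih,
      mul_comm p₁, ← cr_apply, fockInner_cr_left, an_apply]

omit [Fintype ι] in
/-- **Master intertwining, creation**: `X_q · 𝒯ξ = 𝒯(γ_q X_qξ + σ_q ∂_{σq}ξ + √N₀[q=z]ξ)`,
i.e. `a†_q W T = W T (γ_q a†_q + σ_q a_{-q} + √N₀δ_{q,0})` on finite-excitation vectors.
[cite: BastiCenatiempoSchlein2021, (2.2), (2.11)] -/
theorem X_mul_bogT (hσ : Function.Involutive σ) (hP : ∀ p ∈ P, σ p ∉ P) (hσz : σ z = z)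
    (ht : ∀ p ∈ P, |t p| < 1) (q : ι) (ξ : MvPolynomial ι ℂ) :
    X q * bogT z σ P N₀ t ξ = bogT z σ P N₀ t (conjCr z σ P N₀ t q ξ) := by
  have h := bCr_range_comm (N₀ := N₀) hσ hP hσz ht
  simp only [conjCr, LinearMap.add_apply, LinearMap.smul_apply, LinearMap.id_apply, cr_apply,
    an_apply, smul_eq_C_mul]
  rw [bogT_add h, bogT_add h, bogT_C_mul h, bogT_C_mul h, bogT_C_mul h, bogT_X_mul h,
    bogT_pderiv hσ hP hσz ht]
  exact cr_eq_bCr_bAn hσ hP hσz ht q _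

omit [Fintype ι] in
/-- **Master intertwining, annihilation**: `d_q 𝒯ξ = 𝒯(γ_q ∂_qξ + σ_q X_{σq}ξ + √N₀[q=z]ξ)`,
i.e. `a_q W T = W T (γ_q a_q + σ_q a†_{-q} + √N₀δ_{q,0})` on finite-excitation vectors, read in
the Gaussian picture. [cite: BastiCenatiempoSchlein2021, (2.2), (2.11)] -/
theorem dOp_bogT (hσ : Function.Involutive σ) (hP : ∀ p ∈ P, σ p ∉ P) (hσz : σ z = z)
    (ht : ∀ p ∈ P, |t p| < 1) (q : ι) (ξ : MvPolynomial ι ℂ) :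
    dOp z σ P N₀ t q (bogT z σ P N₀ t ξ) = bogT z σ P N₀ t (conjAn z σ P N₀ t q ξ) := by
  have h := bCr_range_comm (N₀ := N₀) hσ hP hσz ht
  simp only [conjAn, LinearMap.add_apply, LinearMap.smul_apply, LinearMap.id_apply, cr_apply,
    an_apply, smul_eq_C_mul]
  rw [bogT_add h, bogT_add h, bogT_C_mul h, bogT_C_mul h, bogT_C_mul h, bogT_X_mul h,
    bogT_pderiv hσ hP hσz ht]
  exact dOp_eq_bAn_bCr hσ hP hσz ht q _

end Wick

end Fock

end Literature.MathematicalPhysics.QuantumManyBody.BoseGas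

end
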